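import Literature.MathematicalPhysics.QuantumFieldTheory.WilsonFinTorusFluxEnergies
import Literature.MathematicalPhysics.QuantumFieldTheory.WilsonFinTorusSliceObservables
import Literature.MathematicalPhysics.QuantumFieldTheory.WilsonOneLinkIntegral
import Literature.MathematicalPhysics.QuantumFieldTheory.WilsonFinTorusTwistedPartitionSwap
import Literature.Analysis.OperatorTheory.TwistedKernelFluxPopulation
import HarnessLib

/-!
# Every electric flux of a finite box is populated: Polyakov loops create non-zero flux states

Topic `Literature/MathematicalPhysics/QuantumFieldTheory`; sequel of `WilsonFinTorusElectricFluxSectors.lean` /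
`WilsonFinTorusFluxEnergies.lean` ('t Hooft's flux-projected partition functions
`Z_ψ(n) = wilsonFinTorusFluxPartition ρ β φ ψ b₁ b₂ b₃ n` of the box `b₁ × b₂ × b₃ × n` for a finite abelian group `Γ` of
central temporal twists `φ`, and the flux energies `E_ψ = wilsonFinTorusFluxEnergy …`, whose existence ∕ positivity
theorems carry the hypothesis «the sector is POPULATED», `0 < Re Z_ψ(3)`).  No named facts; the only definitions are
the Polyakov holonomies of a slice along its second and third axes (`finSlicePolyakovHolonomy₁`, `…₂`, Part II).

AS PRINTED.  G. 't Hooft, Nucl. Phys. B 153 (1979) 141, §4 (4.6)–(4.10) (reprint C. Rebbi (ed.), *Lattice Gauge Theories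
and Monte Carlo Simulations* (1983) p. 552): for a closed curve `C` winding the box once in the 3-direction the loop
operator `A(C) = N⁻¹ Tr P exp ig ∮_C A` satisfies `A(C) → e^{−2πik₃/N} A(C)` under `Ω[k]` ((4.8)), hence
`A(C)Ω[k]|ψ⟩ = Ω[k] e^{−2πik₃/N} A(C)|ψ⟩` ((4.9)) and `|ψ'⟩ = A(C)|ψ⟩` «has `e₃` replaced by `e₃ + 1`» ((4.10)): «A(C) can be
considered to be the creation operator of an electric flux line … The conserved integers `eᵢ` therefore indicate total
amount of electric flux in the three directions.»  On the lattice (time = axis 3 of the box, the Polyakov line of a time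
slice along its first axis, `finSlicePolyakovHolonomy`; its centre charge under the slice twist is the tree's
`trace_rep_finSlicePolyakovHolonomy_finSliceTwist`) the content of (4.10) that is NOT automatic is that `A(C)|0⟩` is a
NON-ZERO vector of the physical (Gauss-law projected) Hilbert space.  We prove it for Wilson's action at every `β > 0`:

* ★ `wilsonFinTorusFluxPartition_re_pos_of_unitFlux` — for `β > 0`, a compact metrisable `G`, a continuous unitary
  `ρ : G →* U(N)` (`N ≥ 1`), a box with `b₁, b₂, b₃ ≥ 1`, central temporal twists `φ : Γ → (Fin 4 → G)` (`φ 0 = 1`,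
  `φ (k + k') = φ k φ k'`) and the character `ψ` BY WHICH `ρ` SEES THE TWIST IN DIRECTION 0, `ρ(φ k 0) = ψ(k)·1`:
  **`0 < Re Z_ψ(M+2)` for every `M`** — the unit electric flux in direction 0 is populated on every box;
  `wilsonFinTorusFluxPartition_re_pos_of_unitFlux_neg` — likewise for `−ψ` (the oppositely oriented line);
* consequently 't Hooft's flux energy of that sector is UNCONDITIONALLY defined and positive:
  `tendsto_wilsonFinTorusFluxEnergy_of_unitFlux` (the limit `(1/M) log (Z_0/Z_ψ) → E_ψ` exists),
  `neg_log_tanh_le_wilsonFinTorusFluxEnergy_of_unitFlux`, `wilsonFinTorusFluxEnergy_pos_of_unitFlux`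
  (`E_ψ ≥ −log tanh(3Nβ·b₁b₂b₃) > 0` for `ψ ≠ 0`).

MECHANISM (all proved here or in the companions).  The witness is `u(b) = e^{+β S_sp(b)/2} · tr ρ(P_q(b))`, the traced
Polyakov loop of the slice divided by the half spatial weight: it has flux `ψ` ((4.8)), and one transfer step gives
`(κu)(a) = e^{−β S_sp(a)/2} ∫_g ∫_b e^{−β S_tm(a,g,b)} tr ρ(P_q(b))`.  Gauge invariance of the trace removes the Gauss-law
average (`integral_integral_exp_neg_finTorusTemporalAction_mul`: substitute `b ↦ b^{g⁻¹}`), the temporal weight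
factorises over links into one-link weights `f_β(a_l b_l⁻¹)` (`exp_neg_finTorusTemporalAction_one_eq_prod`), and at the
configuration `a = (g on the first link of the line, 1 elsewhere)` the integral is
`H^{#other links} · tr(M(β)^{b₁} ρ(g))` with `H = ∫ f_β > 0` and `M(β)` the one-link matrix
(`integral_prod_oneLinkWeight_mul_trace_polyakov`; `WilsonOneLinkIntegral.lean`).  Since `g ↦ tr(M(β)^{b₁} ρ(g))` is
not identically zero (`exists_trace_oneLinkMatrix_pow_mul_rep_ne_zero`) and `κu` is continuous, `κu ≢ 0`, and the
kernel-level criterion `Literature.Analysis.OperatorTheory.exists_fluxCoeff_ne_zero_of_covariant` populates the sector.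

PART II — EVERY ELECTRIC FLUX ('t Hooft (4.10): «the integers `e_i` count how many times an operator of the form `A(C)`
acted in the various directions»).  With several traced Polyakov loops as the witness:

* `finSlicePolyakovHolonomy₁`, `finSlicePolyakovHolonomy₂` — the Polyakov holonomies of a slice along its axes `1`, `2`
  (centre charge `…_finSliceTwist`, gauge covariance `…_finSliceGaugeTransform`, continuity);
* ★ `integral_prod_oneLinkWeight_mul_prod_trace_lines` — THE LOOP INTEGRAL FOR SEVERAL LINES, abstractly: for any
  finite family of pairwise link-disjoint lines (lists of distinct links of any finite link set) and ANY slice `a`,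
  `H^{Σ|L|} ∫ ∏_l f_β(a_l x_l⁻¹) ∏_L tr ρ(∏_{l∈L} x_l) dx = H^{#links} ∏_L tr(∏_{l∈L} M(β)ρ(a_l))` (disjoint blocks of links
  are independent under the product Haar measure; induction on the family);
  `integral_prod_oneLinkWeight_mul_prod_trace_polyakov` — the same for straight lines along the three axes;
* `wilsonFinTorusFluxPartition_re_pos_of_witness` (`_neg`) — a flux sector carrying a continuous covariant witness that
  survives one transfer step is populated (packaging of the kernel-level criterion);
* ★ `wilsonFinTorusFluxPartition_re_pos_of_lines` ∕ `…_of_flux` (`_neg`) — if `ρ` sees the twist of direction `i`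
  through the character `ψ_i` (`ρ(φ k i) = ψ_i(k)·1`, `i = 0, 1, 2`), then for all `n₀ ≤ b₂b₃`, `n₁ ≤ b₁b₃`, `n₂ ≤ b₁b₂`
  **`0 < Re Z_{n₀ψ₀+n₁ψ₁+n₂ψ₂}(M+2)`** for every `M` (`n_i` distinct parallel lines in direction `i`);
* ★ `wilsonFinTorusFluxPartition_re_pos_of_mem_closure` — given room `ord(ψ_i) ≤ (transverse area)_i + 1`, EVERY `χ` in
  the subgroup of `Γ̂` generated by `ψ₀, ψ₁, ψ₂` is populated (for `SU(N)`, the fundamental `ρ` and the centre twists: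
  every `e ∈ (ℤ/N)³`);
* `tendsto_wilsonFinTorusFluxEnergy_of_flux`, `neg_log_tanh_le_wilsonFinTorusFluxEnergy_of_flux`,
  `wilsonFinTorusFluxEnergy_pos_of_flux`, `wilsonFinTorusFluxEnergy_pos_of_mem_closure` — the flux energies of all
  these sectors exist and are `≥ −log tanh(3Nβ·b₁b₂b₃) > 0` (non-zero flux), unconditionally;
* `wilsonFinTorusFluxPartition_swap01` ∕ `_swap02` (exchange of two spatial axes relabels the twist family,
  `WilsonFinTorusTwistedPartitionSwap.lean`) and `wilsonFinTorusFluxPartition_re_pos_of_unitFlux₁` ∕ `₂` — the unit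
  flux along axis `1` (resp. `2`) is populated assuming only `ρ(φ k 1) = ψ(k)·1` (resp. direction `2`).

HONEST FRAMING: one finite box at fixed `β`; this removes a hypothesis from the finite-box flux-energy theorems and says
nothing about the behaviour of `E_ψ` as the box grows ('t Hooft §7), duality, an area law or a mass gap.  Not treated:
fluxes of mixed sign beyond the subgroup statement (reversed individual lines), boxes with less transverse room than
`ord(ψ_i) − 1` lines (TODO(general form): several windings of one line need higher one-link moments).

References: 't Hooft 1979 §4 (4.6)–(4.10), §5 (5.1)–(5.4); I. Montvay, G. Münster, *Quantum Fields on a Lattice* (1994)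
§3.2.6 (3.137)–(3.146), §3.2.8 (3.184)–(3.187); J. Greensite, *An Introduction to the Confinement Problem* (2011) §4.4.
-/

noncomputable section

open MeasureTheory Filter Function Finset Topology
open scoped ENNReal ComplexConjugate BigOperators Matrix
open Literature.Analysis.OperatorTheory Literature.RepresentationTheory.CompactGroups
open Literature.Barriers.QuantumFields

namespace Literature.MathematicalPhysics.QuantumFieldTheory

/-! ### Telescoping along a closed line; gauge covariance of the slice Polyakov holonomy -/

section Telescope

variable {G : Type*} [Group G]

/-- Two-sided telescoping of an ordered product (plumbing). [folklore] -/
private theorem prod_ofFn_mul_mul_inv_telescope :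
    ∀ {m : ℕ} (f : Fin m → G) (d : Fin (m + 1) → G),
      (List.ofFn fun k : Fin m => d k.castSucc * f k * (d k.succ)⁻¹).prod =
        d 0 * (List.ofFn f).prod * (d (Fin.last m))⁻¹
  | 0, f, d => by simp
  | m + 1, f, d => by
    rw [List.ofFn_succ, List.prod_cons, List.ofFn_succ, List.prod_cons]
    have ih := prod_ofFn_mul_mul_inv_telescope (fun k => f k.succ) (fun k => d k.succ)
    have htail : (fun i : Fin m => d i.succ.castSucc * f i.succ * (d i.succ.succ)⁻¹) =
        fun i => d i.castSucc.succ * f i.succ * (d i.succ.succ)⁻¹ := by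
      funext i
      rw [Fin.succ_castSucc]
    rw [htail, ih, Fin.castSucc_zero, Fin.succ_last]
    group

/-- Cyclic telescoping along a closed line of `m + 1` links: `∏_k d_k f_k d_{k+1}⁻¹ = d₀ (∏_k f_k) d₀⁻¹` (indices mod
`m + 1`; plumbing). [folklore] -/
private theorem prod_ofFn_mul_mul_inv_finRotate {m : ℕ} (f d : Fin (m + 1) → G) :
    (List.ofFn fun k : Fin (m + 1) => d k * f k * (d (finRotate (m + 1) k))⁻¹).prod =
      d 0 * (List.ofFn f).prod * (d 0)⁻¹ := by
  have h : (fun k : Fin (m + 1) => d k * f k * (d (finRotate (m + 1) k))⁻¹) =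
      fun k => (Fin.snoc d (d 0) : Fin (m + 2) → G) k.castSucc * f k *
        ((Fin.snoc d (d 0) : Fin (m + 2) → G) k.succ)⁻¹ := by
    funext k
    rw [Fin.snoc_castSucc]
    congr 2
    rcases Fin.eq_castSucc_or_eq_last k with ⟨j, rfl⟩ | rfl
    · have h1 : finRotate (m + 1) j.castSucc = j.succ := by
        ext
        rw [coe_finRotate_of_ne_last (Fin.castSucc_lt_last j).ne, Fin.val_castSucc, Fin.val_succ]
      rw [h1, Fin.succ_castSucc, Fin.snoc_castSucc]
    · rw [finRotate_last, Fin.succ_last, Fin.snoc_last]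
  have h0 : (Fin.snoc d (d 0) : Fin (m + 2) → G) 0 = d 0 := by
    show (Fin.snoc d (d 0) : Fin (m + 2) → G) (0 : Fin (m + 1)).castSucc = d 0
    rw [Fin.snoc_castSucc]
  rw [h, prod_ofFn_mul_mul_inv_telescope f (Fin.snoc d (d 0)), h0, Fin.snoc_last]

variable {b₁ b₂ b₃ : ℕ}

/-- **Gauge covariance of the slice Polyakov holonomy**: under the gauge transformation `x ↦ x^c`,
`x_{p,i} ↦ c_p x_{p,i} c_{p+eᵢ}⁻¹`, the holonomy of the closed line `{(k, q)}_k` is conjugated by the gauge group element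
at its base point: `P_q(x^c) = c_{(0,q)} P_q(x) c_{(0,q)}⁻¹` (telescoping around the periodic direction).
[cite: tHooft1979Flux, §4 (4.6)–(4.8)] [cite: BorgsSeiler1983, §II.3 Lemma II.4 (p. 336)] -/
theorem finSlicePolyakovHolonomy_finSliceGaugeTransform [NeZero b₁] (c : FinSpatialSite b₁ b₂ b₃ → G)
    (x : FinSpatialSite b₁ b₂ b₃ × Fin 3 → G) (q : Fin b₂ × Fin b₃) :
    finSlicePolyakovHolonomy (finSliceGaugeTransform c x) q =
      c (0, q.1, q.2) * finSlicePolyakovHolonomy x q * (c (0, q.1, q.2))⁻¹ := by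
  obtain ⟨m, hm⟩ := Nat.exists_eq_succ_of_ne_zero (NeZero.ne b₁)
  subst hm
  unfold finSlicePolyakovHolonomy
  have h : (fun k : Fin (m + 1) => finSliceGaugeTransform c x ((k, q.1, q.2), 0)) =
      fun k => (fun k' : Fin (m + 1) => c (k', q.1, q.2)) k * x ((k, q.1, q.2), 0) *
        ((fun k' : Fin (m + 1) => c (k', q.1, q.2)) (finRotate (m + 1) k))⁻¹ := by
    funext k
    rfl
  rw [h, prod_ofFn_mul_mul_inv_finRotate]

variable {N : ℕ} (ρ : G →* Matrix (Fin N) (Fin N) ℂ)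

/-- **The traced Polyakov loop of a slice is gauge invariant** (`tr ρ(c P c⁻¹) = tr ρ(P)`).
[cite: tHooft1979Flux, §4 (4.6)–(4.8)] [cite: BorgsSeiler1983, §II.3 Lemma II.4 (p. 336)] -/
theorem trace_rep_finSlicePolyakovHolonomy_finSliceGaugeTransform [NeZero b₁] (c : FinSpatialSite b₁ b₂ b₃ → G)
    (x : FinSpatialSite b₁ b₂ b₃ × Fin 3 → G) (q : Fin b₂ × Fin b₃) :
    (ρ (finSlicePolyakovHolonomy (finSliceGaugeTransform c x) q)).trace = (ρ (finSlicePolyakovHolonomy x q)).trace := by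
  rw [finSlicePolyakovHolonomy_finSliceGaugeTransform, CompactGroup.trace_conj_eq ρ]

end Telescope

/-! ### Removing the Gauss-law average against a gauge-invariant slice function -/

section GaugeAverage

variable {b₁ b₂ b₃ : ℕ} {G : Type*} [Group G] {N : ℕ} (ρ : G →* Matrix (Fin N) (Fin N) ℂ)

/-- The trivial gauge transformation. [cite: Wilson1974] -/
theorem finSliceGaugeTransform_one (x : FinSpatialSite b₁ b₂ b₃ × Fin 3 → G) :
    finSliceGaugeTransform (1 : FinSpatialSite b₁ b₂ b₃ → G) x = x := by
  funext l
  simp [finSliceGaugeTransform]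

/-- **Temporal gauge**: `S_tm(a, g, b^{g⁻¹}) = S_tm(a, 1, b)` — the temporal links are absorbed into a gauge
transformation of the next slice (Montvay–Münster (3.137)–(3.138)). [cite: MontvayMunster1994, §3.2.6 (3.137)–(3.138)] -/
theorem finTorusTemporalAction_finSliceGaugeTransform_inv (a : FinSpatialSite b₁ b₂ b₃ × Fin 3 → G)
    (g : FinSpatialSite b₁ b₂ b₃ → G) (b : FinSpatialSite b₁ b₂ b₃ × Fin 3 → G) :
    finTorusTemporalAction ρ a g (finSliceGaugeTransform g⁻¹ b) = finTorusTemporalAction ρ a 1 b := by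
  have h := finTorusTemporalAction_gaugeTransform_div ρ 1 g⁻¹ a b
  rwa [finSliceGaugeTransform_one, one_div, inv_inv] at h

/-- **The temporal Boltzmann weight in temporal gauge factorises over links** into one-link weights:
`exp(−β S_tm(a, 1, b)) = ∏_l f_β(a_l b_l⁻¹)` (Montvay–Münster (3.184)). [cite: MontvayMunster1994, §3.2.8 (3.184)] -/
theorem exp_neg_finTorusTemporalAction_one_eq_prod (β : ℝ) (a b : FinSpatialSite b₁ b₂ b₃ × Fin 3 → G) :
    Real.exp (-(β * finTorusTemporalAction ρ a 1 b)) = ∏ l, oneLinkWeight ρ β (a l * (b l)⁻¹) := by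
  unfold finTorusTemporalAction
  simp only [Pi.one_apply, mul_one, inv_one, oneLinkWeight_def]
  rw [Fintype.prod_prod_type, Finset.mul_sum, ← Finset.sum_neg_distrib, Real.exp_sum]
  refine Finset.prod_congr rfl fun p _ => ?_
  rw [Finset.mul_sum, ← Finset.sum_neg_distrib, Real.exp_sum]

variable [TopologicalSpace G] [IsTopologicalGroup G] [CompactSpace G] [MeasurableSpace G] [BorelSpace G]
  [SecondCountableTopology G]

/-- Continuous functions on a compact space with a finite measure are integrable (plumbing). [folklore] -/
private theorem integrable_of_continuous_cpt {X : Type*} [TopologicalSpace X] [CompactSpace X] [MeasurableSpace X]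
    [OpensMeasurableSpace X] {μ : Measure X} [IsFiniteMeasure μ] {E : Type*} [NormedAddCommGroup E] {f : X → E}
    (hf : Continuous f) : Integrable f μ :=
  hf.integrable_of_hasCompactSupport (HasCompactSupport.of_compactSpace f)

/-- **Removing the Gauss-law average.**  For a continuous GAUGE-INVARIANT slice function `v` and any slice `a`,
`∫_b (∫_g e^{−β S_tm(a,g,b)} dg) v(b) db = ∫_b e^{−β S_tm(a,1,b)} v(b) db`: for each `g` substitute `b ↦ b^{g⁻¹}`
(a measure-preserving gauge transformation of the slice, `S_tm(a, g, b^{g⁻¹}) = S_tm(a, 1, b)`, `v(b^{g⁻¹}) = v(b)`), so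
the inner `b`-integral does not depend on `g` — the projection onto gauge-invariant states acts trivially on a
gauge-invariant vector (Montvay–Münster (3.137)–(3.144); 't Hooft's `P` of (5.1)). [cite: MontvayMunster1994, §3.2.6 (3.137)–(3.144)]
[cite: tHooft1979Flux, §5 (5.1)–(5.3)] -/
theorem integral_integral_exp_neg_finTorusTemporalAction_mul (hρ : Continuous ρ) (β : ℝ)
    {v : (FinSpatialSite b₁ b₂ b₃ × Fin 3 → G) → ℂ} (hvc : Continuous v)
    (hvg : ∀ (c : FinSpatialSite b₁ b₂ b₃ → G) (x : FinSpatialSite b₁ b₂ b₃ × Fin 3 → G),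
      v (finSliceGaugeTransform c x) = v x)
    (a : FinSpatialSite b₁ b₂ b₃ × Fin 3 → G) :
    ∫ b, ((∫ g, Real.exp (-(β * finTorusTemporalAction ρ a g b))
        ∂(Measure.pi fun _ : FinSpatialSite b₁ b₂ b₃ => haarProbability G) : ℝ) : ℂ) * v b
        ∂(Measure.pi fun _ : FinSpatialSite b₁ b₂ b₃ × Fin 3 => haarProbability G) =
      ∫ b, (Real.exp (-(β * finTorusTemporalAction ρ a 1 b)) : ℂ) * v b
        ∂(Measure.pi fun _ : FinSpatialSite b₁ b₂ b₃ × Fin 3 => haarProbability G) := by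
  set μS : Measure (FinSpatialSite b₁ b₂ b₃ × Fin 3 → G) := Measure.pi fun _ => haarProbability G with hμS
  set μG : Measure (FinSpatialSite b₁ b₂ b₃ → G) := Measure.pi fun _ => haarProbability G with hμG
  -- the integrand as a function of `(b, g)` is continuous, hence integrable on the product
  have hE : Continuous fun z : (FinSpatialSite b₁ b₂ b₃ × Fin 3 → G) × (FinSpatialSite b₁ b₂ b₃ → G) =>
      (Real.exp (-(β * finTorusTemporalAction ρ a z.2 z.1)) : ℂ) * v z.1 :=
    (Complex.continuous_ofReal.comp (Real.continuous_exp.comp (continuous_const.mul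
      ((continuous_finTorusTemporalAction ρ hρ).comp (continuous_const.prodMk
        (continuous_snd.prodMk continuous_fst)))).neg)).mul (hvc.comp continuous_fst)
  have hint : Integrable (uncurry fun (b : FinSpatialSite b₁ b₂ b₃ × Fin 3 → G) (g : FinSpatialSite b₁ b₂ b₃ → G) =>
      (Real.exp (-(β * finTorusTemporalAction ρ a g b)) : ℂ) * v b) (μS.prod μG) :=
    integrable_of_continuous_cpt hE
  -- Step 1: write the product as a double integral
  have h1 : ∀ b, ((∫ g, Real.exp (-(β * finTorusTemporalAction ρ a g b)) ∂μG : ℝ) : ℂ) * v b =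
      ∫ g, (Real.exp (-(β * finTorusTemporalAction ρ a g b)) : ℂ) * v b ∂μG := fun b => by
    rw [← integral_complex_ofReal, ← integral_mul_const]
  simp_rw [h1]
  -- Step 2: swap the order of integration
  rw [integral_integral_swap hint]
  -- Step 3: the inner integral does not depend on `g`
  have h3 : ∀ g : FinSpatialSite b₁ b₂ b₃ → G,
      ∫ b, (Real.exp (-(β * finTorusTemporalAction ρ a g b)) : ℂ) * v b ∂μS =
        ∫ b, (Real.exp (-(β * finTorusTemporalAction ρ a 1 b)) : ℂ) * v b ∂μS := fun g => by
    have hmp := measurePreserving_finSliceGaugeTransform (b₁ := b₁) (b₂ := b₂) (b₃ := b₃) g⁻¹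
    have hF : Continuous fun b : FinSpatialSite b₁ b₂ b₃ × Fin 3 → G =>
        (Real.exp (-(β * finTorusTemporalAction ρ a g b)) : ℂ) * v b := by
      have h := hE.comp (continuous_id.prodMk (continuous_const (y := g)))
      exact h
    have hFm : AEStronglyMeasurable (fun b : FinSpatialSite b₁ b₂ b₃ × Fin 3 → G =>
        (Real.exp (-(β * finTorusTemporalAction ρ a g b)) : ℂ) * v b)
        (Measure.map (finSliceGaugeTransform g⁻¹) μS) := by
      rw [hmp.map_eq]
      exact hF.aestronglyMeasurable
    have h2 := integral_map (μ := μS) hmp.measurable.aemeasurable hFm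
    rw [hmp.map_eq] at h2
    rw [h2]
    refine integral_congr_ae (Eventually.of_forall fun b => ?_)
    dsimp only
    rw [finTorusTemporalAction_finSliceGaugeTransform_inv, hvg]
  calc ∫ g, ∫ b, (Real.exp (-(β * finTorusTemporalAction ρ a g b)) : ℂ) * v b ∂μS ∂μG
      = ∫ _g : FinSpatialSite b₁ b₂ b₃ → G, ∫ b, (Real.exp (-(β * finTorusTemporalAction ρ a 1 b)) : ℂ) * v b ∂μS ∂μG :=
        integral_congr_ae (Eventually.of_forall h3)
    _ = ∫ b, (Real.exp (-(β * finTorusTemporalAction ρ a 1 b)) : ℂ) * v b ∂μS := by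
        rw [integral_const]
        simp

end GaugeAverage

/-! ### The loop integral: link factorisation and the one-link matrix -/

section Loop

variable {b₁ b₂ b₃ : ℕ} {G : Type*} [Group G] {N : ℕ} (ρ : G →* Matrix (Fin N) (Fin N) ℂ)

variable [TopologicalSpace G] [IsTopologicalGroup G] [CompactSpace G] [MeasurableSpace G] [BorelSpace G]
  [SecondCountableTopology G]

/-- Continuity of an ordered product of continuous factors (plumbing). [folklore] -/
private theorem continuous_prod_ofFn' {X : Type*} [TopologicalSpace X] {M : Type*} [Monoid M] [TopologicalSpace M]
    [ContinuousMul M] :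
    ∀ {k : ℕ} (f : Fin k → X → M), (∀ i, Continuous (f i)) → Continuous fun x => (List.ofFn fun i => f i x).prod
  | 0, f, _ => by simpa [List.ofFn_zero] using continuous_const
  | k + 1, f, hf => by
    simp_rw [List.ofFn_succ, List.prod_cons]
    exact (hf 0).mul (continuous_prod_ofFn' (fun i => f i.succ) fun i => hf i.succ)

/-- Continuous functions on a compact space with a finite measure are integrable (plumbing). [folklore] -/
private theorem integrable_of_continuous_cpt' {X : Type*} [TopologicalSpace X] [CompactSpace X] [MeasurableSpace X]
    [OpensMeasurableSpace X] {μ : Measure X} [IsFiniteMeasure μ] {E : Type*} [NormedAddCommGroup E] {f : X → E}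
    (hf : Continuous f) : Integrable f μ :=
  hf.integrable_of_hasCompactSupport (HasCompactSupport.of_compactSpace f)

/-- **Iterated one-link integrals along an open chain** (plumbing for the loop integral): for `c : Fin n → G` and a
matrix `B`, `∫ ∏_k f_β(c_k y_k⁻¹) · (B ρ(y₀) ⋯ ρ(y_{n−1}))_{ij} ∏ dy_k = (B ∏_k M(β) ρ(c_k))_{ij}` — peel the first link
(Fubini) and use `integral_oneLinkWeight_mul_inv_mul_rep_apply`. [cite: MontvayMunster1994, §3.2.8 (3.184)–(3.187)] -/
private theorem integral_prod_oneLinkWeight_mul_listProd_apply (hρ : Continuous ρ) (β : ℝ) :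
    ∀ (n : ℕ) (c : Fin n → G) (B : Matrix (Fin N) (Fin N) ℂ) (i j : Fin N),
      ∫ y : Fin n → G, (∏ k, (oneLinkWeight ρ β (c k * (y k)⁻¹) : ℂ)) *
          (B * (List.ofFn fun k => ρ (y k)).prod) i j ∂(Measure.pi fun _ => haarProbability G) =
        (B * (List.ofFn fun k => oneLinkMatrix ρ β * ρ (c k)).prod) i j
  | 0, c, B, i, j => by simp
  | n + 1, c, B, i, j => by
    have IH := fun B' : Matrix (Fin N) (Fin N) ℂ =>
      integral_prod_oneLinkWeight_mul_listProd_apply hρ β n (fun k => c k.succ) B' i j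
    set μ := haarProbability G with hμ
    set L : Matrix (Fin N) (Fin N) ℂ := (List.ofFn fun k : Fin n => oneLinkMatrix ρ β * ρ (c k.succ)).prod with hL
    have hw : Continuous fun g : G => (oneLinkWeight ρ β g : ℂ) :=
      Complex.continuous_ofReal.comp (continuous_oneLinkWeight ρ hρ β)
    -- the integrand after splitting off the first link, and its continuity
    have hΦc : Continuous fun z : G × (Fin n → G) => (oneLinkWeight ρ β (c 0 * z.1⁻¹) : ℂ) *
        ((∏ k, (oneLinkWeight ρ β (c k.succ * (z.2 k)⁻¹) : ℂ)) *
          ((B * ρ z.1) * (List.ofFn fun k => ρ (z.2 k)).prod) i j) := by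
      refine (hw.comp (continuous_const.mul continuous_fst.inv)).mul ((continuous_finsetProd _ fun k _ =>
        hw.comp (continuous_const.mul ((continuous_apply k).comp continuous_snd).inv)).mul ?_)
      exact Continuous.matrix_elem (((continuous_const.matrix_mul (hρ.comp continuous_fst)).matrix_mul
        (continuous_prod_ofFn' (fun (k : Fin n) (z : G × (Fin n → G)) => ρ (z.2 k)) fun k =>
          hρ.comp ((continuous_apply k).comp continuous_snd)))) i j
    -- Step 1: `G^{n+1} ≃ G × G^n`
    have hsplit : ∫ y : Fin (n + 1) → G, (∏ k, (oneLinkWeight ρ β (c k * (y k)⁻¹) : ℂ)) *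
          (B * (List.ofFn fun k => ρ (y k)).prod) i j ∂(Measure.pi fun _ => μ) =
        ∫ z : G × (Fin n → G), (oneLinkWeight ρ β (c 0 * z.1⁻¹) : ℂ) *
          ((∏ k, (oneLinkWeight ρ β (c k.succ * (z.2 k)⁻¹) : ℂ)) *
            ((B * ρ z.1) * (List.ofFn fun k => ρ (z.2 k)).prod) i j) ∂(μ.prod (Measure.pi fun _ => μ)) := by
      rw [← ((measurePreserving_piFinSuccAbove (fun _ : Fin (n + 1) => μ) 0).symm).integral_comp']
      refine integral_congr_ae (ae_of_all _ fun z => ?_)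
      simp only [MeasurableEquiv.piFinSuccAbove_symm_apply, Fin.insertNthEquiv, Equiv.coe_fn_mk,
        Fin.insertNth_zero', List.ofFn_succ, List.prod_cons, Fin.cons_zero, Fin.cons_succ, Fin.prod_univ_succ,
        mul_assoc]
    rw [hsplit, integral_prod _ (integrable_of_continuous_cpt' hΦc)]
    dsimp only
    -- Step 2: the inner integral by the induction hypothesis (with `B ρ(x)` in place of `B`)
    have hinner : ∀ x : G, ∫ y : Fin n → G, (oneLinkWeight ρ β (c 0 * x⁻¹) : ℂ) *
          ((∏ k, (oneLinkWeight ρ β (c k.succ * (y k)⁻¹) : ℂ)) *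
            ((B * ρ x) * (List.ofFn fun k => ρ (y k)).prod) i j) ∂(Measure.pi fun _ => μ) =
        (oneLinkWeight ρ β (c 0 * x⁻¹) : ℂ) * ((B * ρ x) * L) i j := fun x => by
      rw [integral_const_mul, IH (B * ρ x)]
    simp_rw [hinner]
    -- Step 3: the outer one-link integral
    have hexp : ∀ x : G, (oneLinkWeight ρ β (c 0 * x⁻¹) : ℂ) * ((B * ρ x) * L) i j =
        ∑ l', ∑ l, B i l * ((oneLinkWeight ρ β (c 0 * x⁻¹) : ℂ) * ρ x l l') * L l' j := fun x => by
      rw [Matrix.mul_apply, Finset.mul_sum]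
      refine Finset.sum_congr rfl fun l' _ => ?_
      rw [Matrix.mul_apply, Finset.sum_mul, Finset.mul_sum]
      exact Finset.sum_congr rfl fun l _ => by ring
    simp_rw [hexp]
    have hint : ∀ l l', Integrable (fun x : G => B i l * ((oneLinkWeight ρ β (c 0 * x⁻¹) : ℂ) * ρ x l l') * L l' j) μ :=
      fun l l' => integrable_of_continuous_cpt' ((continuous_const.mul
        ((hw.comp (continuous_const.mul continuous_id.inv)).mul (hρ.matrix_elem l l'))).mul continuous_const)
    rw [integral_finsetSum _ fun l' _ => integrable_finsetSum _ fun l _ => hint l l']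
    have hl' : ∀ l', ∫ x, ∑ l, B i l * ((oneLinkWeight ρ β (c 0 * x⁻¹) : ℂ) * ρ x l l') * L l' j ∂μ =
        ∑ l, B i l * (oneLinkMatrix ρ β * ρ (c 0)) l l' * L l' j := fun l' => by
      rw [integral_finsetSum _ fun l _ => hint l l']
      refine Finset.sum_congr rfl fun l _ => ?_
      rw [integral_mul_const, integral_const_mul, integral_oneLinkWeight_mul_inv_mul_rep_apply ρ hρ β (c 0)]
    rw [Finset.sum_congr rfl fun l' _ => hl' l', List.ofFn_succ, List.prod_cons, ← hL, ← Matrix.mul_assoc,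
      Matrix.mul_apply]
    refine Finset.sum_congr rfl fun l' _ => ?_
    rw [Matrix.mul_apply, Finset.sum_mul]

/-- **The loop integral.**  At the slice `a = (g on the first link of the line, 1 elsewhere)`,
`∫_b ∏_l f_β(a_l b_l⁻¹) · tr ρ(P_q(b)) db = H^{#links off the line} · tr(M(β)^{b₁} ρ(g))`, `H = ∫ f_β`: the links off the
line integrate to `H` each, the `b₁` links of the line to the ordered product `M ρ(g) M ⋯ M` (cyclicity of the trace).
[cite: MontvayMunster1994, §3.2.8 (3.184)–(3.187)] [cite: tHooft1979Flux, §4 (4.6)–(4.10)] -/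
theorem integral_prod_oneLinkWeight_mul_trace_polyakov (hρ : Continuous ρ) (β : ℝ) [NeZero b₁] (q : Fin b₂ × Fin b₃)
    (g : G) :
    ∫ b, (∏ l, (oneLinkWeight ρ β (Function.update (1 : FinSpatialSite b₁ b₂ b₃ × Fin 3 → G) (((0 : Fin b₁), q.1, q.2), 0)
          g l * (b l)⁻¹) : ℂ)) * (ρ (finSlicePolyakovHolonomy b q)).trace
        ∂(Measure.pi fun _ : FinSpatialSite b₁ b₂ b₃ × Fin 3 => haarProbability G) =
      ((∫ x, oneLinkWeight ρ β x ∂haarProbability G : ℝ) : ℂ) ^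
          Fintype.card {l : FinSpatialSite b₁ b₂ b₃ × Fin 3 // ¬ (l.1.2 = q ∧ l.2 = 0)} *
        ((oneLinkMatrix ρ β) ^ b₁ * ρ g).trace := by
  set μ := haarProbability G with hμ
  -- the links `ℓ k = ((k, q), 0)` of the line, the line as a predicate `p`, and `Fin b₁ ≃ {l // p l}`
  set ℓ : Fin b₁ → FinSpatialSite b₁ b₂ b₃ × Fin 3 := fun k => ((k, q.1, q.2), 0) with hℓ
  have hℓinj : Injective ℓ := fun k k' h => by
    simpa [hℓ] using congrArg (fun l : FinSpatialSite b₁ b₂ b₃ × Fin 3 => l.1.1) h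
  set a : FinSpatialSite b₁ b₂ b₃ × Fin 3 → G := Function.update 1 (ℓ 0) g with ha
  set p : FinSpatialSite b₁ b₂ b₃ × Fin 3 → Prop := fun l => l.1.2 = q ∧ l.2 = 0 with hp
  letI hpdec : DecidablePred p := fun l => inferInstanceAs (Decidable (l.1.2 = q ∧ l.2 = 0))
  have hpℓ : ∀ k : Fin b₁, p (ℓ k) := fun k => ⟨rfl, rfl⟩
  have hPℓ : ∀ x : FinSpatialSite b₁ b₂ b₃ × Fin 3 → G,
      finSlicePolyakovHolonomy x q = (List.ofFn fun k : Fin b₁ => x (ℓ k)).prod := fun x => rfl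
  let eqv : Fin b₁ ≃ {l : FinSpatialSite b₁ b₂ b₃ × Fin 3 // p l} :=
    { toFun := fun k => ⟨ℓ k, hpℓ k⟩
      invFun := fun l => l.1.1.1
      left_inv := fun _ => rfl
      right_inv := fun l => by
        obtain ⟨⟨⟨k, q'⟩, i⟩, hq, hi⟩ := l
        apply Subtype.ext
        show (((k, q.1, q.2), (0 : Fin 3)) : FinSpatialSite b₁ b₂ b₃ × Fin 3) = ((k, q'), i)
        simp only at hq hi
        rw [hq, hi] }
  have heqv : ∀ k : Fin b₁, eqv k = ⟨ℓ k, hpℓ k⟩ := fun k => rfl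
  -- the value of `a` on and off the line
  have ha_loop : ∀ k : Fin b₁, a (ℓ k) = if k = 0 then g else 1 := fun k => by
    simp only [ha, Function.update_apply, hℓinj.eq_iff, Pi.one_apply]
  have ha_off : ∀ l : {l : FinSpatialSite b₁ b₂ b₃ × Fin 3 // ¬ p l}, a l = 1 := fun l => by
    have hne : (l : FinSpatialSite b₁ b₂ b₃ × Fin 3) ≠ ℓ 0 := fun h => l.2 (h ▸ hpℓ 0)
    simp only [ha, Function.update_apply, if_neg hne, Pi.one_apply]
  -- Step 1: split the links into the line and the rest
  set e₀ := MeasurableEquiv.piEquivPiSubtypeProd (fun _ : FinSpatialSite b₁ b₂ b₃ × Fin 3 => G) p with he₀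
  have hmp : MeasurePreserving e₀ (Measure.pi fun _ => μ)
      ((Measure.pi fun _ : {l // p l} => μ).prod (Measure.pi fun _ : {l // ¬ p l} => μ)) :=
    measurePreserving_piEquivPiSubtypeProd (fun _ => μ) p
  have he₀p : ∀ (z : ({l // p l} → G) × ({l // ¬ p l} → G)) (l : {l // p l}),
      e₀.symm z (l : FinSpatialSite b₁ b₂ b₃ × Fin 3) = z.1 l := fun z l => by
    simp [he₀, MeasurableEquiv.piEquivPiSubtypeProd, Equiv.piEquivPiSubtypeProd, l.2]
  have he₀n : ∀ (z : ({l // p l} → G) × ({l // ¬ p l} → G)) (l : {l // ¬ p l}),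
      e₀.symm z (l : FinSpatialSite b₁ b₂ b₃ × Fin 3) = z.2 l := fun z l => by
    simp [he₀, MeasurableEquiv.piEquivPiSubtypeProd, Equiv.piEquivPiSubtypeProd, l.2]
  -- the two factors
  set FL : ({l // p l} → G) → ℂ := fun x => (∏ l : {l // p l}, (oneLinkWeight ρ β (a l * (x l)⁻¹) : ℂ)) *
    (ρ (List.ofFn fun k : Fin b₁ => x ⟨ℓ k, hpℓ k⟩).prod).trace with hFL
  set FR : ({l // ¬ p l} → G) → ℂ := fun y => ∏ l : {l // ¬ p l}, (oneLinkWeight ρ β (a l * (y l)⁻¹) : ℂ) with hFR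
  have hfac : ∀ z : ({l // p l} → G) × ({l // ¬ p l} → G),
      (∏ l, (oneLinkWeight ρ β (a l * (e₀.symm z l)⁻¹) : ℂ)) * (ρ (finSlicePolyakovHolonomy (e₀.symm z) q)).trace =
        FL z.1 * FR z.2 := fun z => by
    rw [← Fintype.prod_subtype_mul_prod_subtype p fun l => (oneLinkWeight ρ β (a l * (e₀.symm z l)⁻¹) : ℂ)]
    simp only [hFL, hFR, he₀p, he₀n, hPℓ]
    have hP : (List.ofFn fun k : Fin b₁ => e₀.symm z (ℓ k)) =
        List.ofFn fun k : Fin b₁ => z.1 ⟨ℓ k, hpℓ k⟩ :=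
      List.ofFn_inj.mpr (funext fun k => he₀p z ⟨ℓ k, hpℓ k⟩)
    rw [hP]
    ring
  rw [← (hmp.symm e₀).integral_comp']
  simp_rw [hfac]
  rw [integral_prod_mul FL FR]
  -- Step 2: the links off the line
  have hR : ∫ y, FR y ∂(Measure.pi fun _ : {l // ¬ p l} => μ) =
      ((∫ x, oneLinkWeight ρ β x ∂μ : ℝ) : ℂ) ^ Fintype.card {l : FinSpatialSite b₁ b₂ b₃ × Fin 3 // ¬ p l} := by
    simp only [hFR]
    rw [integral_fintype_prod_eq_prod (fun (l : {l // ¬ p l}) (x : G) => (oneLinkWeight ρ β (a l * x⁻¹) : ℂ))]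
    have h1 : ∀ l : {l // ¬ p l}, ∫ x, (oneLinkWeight ρ β (a l * x⁻¹) : ℂ) ∂μ =
        ((∫ x, oneLinkWeight ρ β x ∂μ : ℝ) : ℂ) := fun l => by
      rw [integral_complex_ofReal, integral_oneLinkWeight_mul_inv ρ hρ β]
    simp_rw [h1]
    rw [Finset.prod_const, Finset.card_univ]
  -- Step 3: the links of the line, transported to `Fin b₁`
  have hL : ∫ x, FL x ∂(Measure.pi fun _ : {l // p l} => μ) = ((oneLinkMatrix ρ β) ^ b₁ * ρ g).trace := by
    set eL := MeasurableEquiv.piCongrLeft (fun _ : {l // p l} => G) eqv with heL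
    have hmL : MeasurePreserving eL (Measure.pi fun _ : Fin b₁ => μ) (Measure.pi fun _ : {l // p l} => μ) :=
      measurePreserving_piCongrLeft (fun _ : {l // p l} => μ) eqv
    rw [← hmL.integral_comp']
    have heLk : ∀ (y : Fin b₁ → G) (k : Fin b₁), eL y ⟨ℓ k, hpℓ k⟩ = y k := fun y k => by
      show (MeasurableEquiv.piCongrLeft (fun _ : {l // p l} => G) eqv) y (eqv k) = y k
      rw [MeasurableEquiv.coe_piCongrLeft, Equiv.piCongrLeft_apply_apply]
    have hFLy : ∀ y : Fin b₁ → G, FL (eL y) =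
        (∏ k : Fin b₁, (oneLinkWeight ρ β ((if k = 0 then g else 1) * (y k)⁻¹) : ℂ)) *
          ((1 : Matrix (Fin N) (Fin N) ℂ) * (List.ofFn fun k : Fin b₁ => ρ (y k)).prod).trace := fun y => by
      have h1 : (∏ l : {l // p l}, (oneLinkWeight ρ β (a l * (eL y l)⁻¹) : ℂ)) =
          ∏ k : Fin b₁, (oneLinkWeight ρ β ((if k = 0 then g else 1) * (y k)⁻¹) : ℂ) := by
        refine (Fintype.prod_equiv eqv _ _ fun k => ?_).symm
        show _ = (oneLinkWeight ρ β (a (ℓ k) * (eL y ⟨ℓ k, hpℓ k⟩)⁻¹) : ℂ)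
        rw [ha_loop, heLk]
      have h2 : (List.ofFn fun k : Fin b₁ => eL y ⟨ℓ k, hpℓ k⟩) = List.ofFn fun k => y k :=
        List.ofFn_inj.mpr (funext fun k => heLk y k)
      simp only [hFL]
      rw [h1, h2, Matrix.one_mul, map_list_prod, List.map_ofFn]
      rfl
    simp_rw [hFLy]
    -- trace = sum of diagonal entries; each by the chain lemma with `B = 1`
    have hmt : ∀ y : Fin b₁ → G, (∏ k : Fin b₁, (oneLinkWeight ρ β ((if k = 0 then g else 1) * (y k)⁻¹) : ℂ)) *
        ((1 : Matrix (Fin N) (Fin N) ℂ) * (List.ofFn fun k : Fin b₁ => ρ (y k)).prod).trace =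
        ∑ i, (∏ k : Fin b₁, (oneLinkWeight ρ β ((if k = 0 then g else 1) * (y k)⁻¹) : ℂ)) *
          ((1 : Matrix (Fin N) (Fin N) ℂ) * (List.ofFn fun k : Fin b₁ => ρ (y k)).prod) i i := fun y => by
      rw [Matrix.trace, Finset.mul_sum]
      rfl
    simp_rw [hmt]
    have hinti : ∀ i : Fin N, Integrable (fun y : Fin b₁ → G =>
        (∏ k : Fin b₁, (oneLinkWeight ρ β ((if k = 0 then g else 1) * (y k)⁻¹) : ℂ)) *
          ((1 : Matrix (Fin N) (Fin N) ℂ) * (List.ofFn fun k : Fin b₁ => ρ (y k)).prod) i i)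
        (Measure.pi fun _ : Fin b₁ => μ) := fun i =>
      integrable_of_continuous_cpt' ((continuous_finsetProd _ fun k _ =>
        (Complex.continuous_ofReal.comp (continuous_oneLinkWeight ρ hρ β)).comp
          (continuous_const.mul (continuous_apply k).inv)).mul
        (Continuous.matrix_elem (continuous_const.matrix_mul (continuous_prod_ofFn'
          (fun (k : Fin b₁) (y : Fin b₁ → G) => ρ (y k)) fun k => hρ.comp (continuous_apply k))) i i))
    rw [integral_finsetSum _ fun i _ => hinti i]
    rw [Finset.sum_congr rfl fun i _ =>
      integral_prod_oneLinkWeight_mul_listProd_apply ρ hρ β b₁ (fun k => if k = 0 then g else 1) 1 i i, Matrix.one_mul]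
    show ((List.ofFn fun k : Fin b₁ => oneLinkMatrix ρ β * ρ (if k = 0 then g else 1)).prod).trace =
      ((oneLinkMatrix ρ β) ^ b₁ * ρ g).trace
    -- the ordered product `M ρ(g) · M ⋯ M = M ρ(g) M^{b₁ - 1}`, and cyclicity
    obtain ⟨m, hm⟩ := Nat.exists_eq_succ_of_ne_zero (NeZero.ne b₁)
    subst hm
    have hprod : (List.ofFn fun k : Fin (m + 1) => oneLinkMatrix ρ β * ρ (if k = 0 then g else 1)).prod =
        oneLinkMatrix ρ β * ρ g * (oneLinkMatrix ρ β) ^ m := by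
      rw [List.ofFn_succ, List.prod_cons]
      simp [Fin.succ_ne_zero, List.ofFn_const, List.prod_replicate]
    rw [hprod, Matrix.trace_mul_cycle, pow_succ]
  rw [hL, hR, mul_comm]

end Loop

/-! ### The Polyakov witness: a flux-carrying slice function that survives one transfer step -/

section Witness

variable {b₁ b₂ b₃ : ℕ} {G : Type*} [Group G] [TopologicalSpace G] [IsTopologicalGroup G] [CompactSpace G]
  [MeasurableSpace G] [BorelSpace G] [SecondCountableTopology G] {N : ℕ} (ρ : G →* Matrix (Fin N) (Fin N) ℂ)

omit [CompactSpace G] [MeasurableSpace G] [BorelSpace G] [SecondCountableTopology G] in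
/-- The Polyakov witness `u(b) = e^{β S_sp(b)/2} · tr ρ(P_q(b))` is continuous (plumbing). [folklore] -/
private theorem continuous_polyakovWitness (hρ : Continuous ρ) (β : ℝ) (q : Fin b₂ × Fin b₃) :
    Continuous fun b : FinSpatialSite b₁ b₂ b₃ × Fin 3 → G =>
      (Real.exp (β * finTorusSpatialAction ρ b / 2) : ℂ) * (ρ (finSlicePolyakovHolonomy b q)).trace :=
  (Complex.continuous_ofReal.comp (Real.continuous_exp.comp ((continuous_const.mul
    (continuous_finTorusSpatialAction ρ hρ)).div_const 2))).mul (hρ.comp (continuous_finSlicePolyakovHolonomy q)).matrix_trace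

/-- **One transfer step applied to the Polyakov witness** `u(b) = e^{β S_sp(b)/2} tr ρ(P_q(b))`:
`∫ K_β(a, b) u(b) db = e^{−β S_sp(a)/2} · ∫ ∏_l f_β(a_l b_l⁻¹) tr ρ(P_q(b)) db` — the half spatial weights at `b` cancel,
the Gauss-law average drops out against the gauge-invariant trace (`integral_integral_exp_neg_finTorusTemporalAction_mul`)
and the temporal weight factorises over links (`exp_neg_finTorusTemporalAction_one_eq_prod`).
[cite: MontvayMunster1994, §3.2.6 (3.144) and §3.2.8 (3.184)] [cite: tHooft1979Flux, §4 (4.6)–(4.8)] -/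
theorem integral_finTorusSliceKernel_mul_polyakovWitness (hρ : Continuous ρ) (β : ℝ) [NeZero b₁] (q : Fin b₂ × Fin b₃)
    (a : FinSpatialSite b₁ b₂ b₃ × Fin 3 → G) :
    ∫ b, (finTorusSliceKernel ρ β a b : ℂ) *
        ((Real.exp (β * finTorusSpatialAction ρ b / 2) : ℂ) * (ρ (finSlicePolyakovHolonomy b q)).trace)
        ∂(Measure.pi fun _ : FinSpatialSite b₁ b₂ b₃ × Fin 3 => haarProbability G) =
      (Real.exp (-(β * finTorusSpatialAction ρ a / 2)) : ℂ) *
        ∫ b, (∏ l, (oneLinkWeight ρ β (a l * (b l)⁻¹) : ℂ)) * (ρ (finSlicePolyakovHolonomy b q)).trace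
          ∂(Measure.pi fun _ : FinSpatialSite b₁ b₂ b₃ × Fin 3 => haarProbability G) := by
  have hvc : Continuous fun b : FinSpatialSite b₁ b₂ b₃ × Fin 3 → G => (ρ (finSlicePolyakovHolonomy b q)).trace :=
    (hρ.comp (continuous_finSlicePolyakovHolonomy q)).matrix_trace
  have hvg : ∀ (c : FinSpatialSite b₁ b₂ b₃ → G) (x : FinSpatialSite b₁ b₂ b₃ × Fin 3 → G),
      (ρ (finSlicePolyakovHolonomy (finSliceGaugeTransform c x) q)).trace = (ρ (finSlicePolyakovHolonomy x q)).trace :=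
    fun c x => trace_rep_finSlicePolyakovHolonomy_finSliceGaugeTransform ρ c x q
  have h1 : ∀ b : FinSpatialSite b₁ b₂ b₃ × Fin 3 → G, (finTorusSliceKernel ρ β a b : ℂ) *
      ((Real.exp (β * finTorusSpatialAction ρ b / 2) : ℂ) * (ρ (finSlicePolyakovHolonomy b q)).trace) =
      (Real.exp (-(β * finTorusSpatialAction ρ a / 2)) : ℂ) *
        (((∫ g, Real.exp (-(β * finTorusTemporalAction ρ a g b))
            ∂(Measure.pi fun _ : FinSpatialSite b₁ b₂ b₃ => haarProbability G) : ℝ) : ℂ) *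
          (ρ (finSlicePolyakovHolonomy b q)).trace) := fun b => by
    have hcancel : (Real.exp (-(β * finTorusSpatialAction ρ b / 2)) : ℂ) *
        (Real.exp (β * finTorusSpatialAction ρ b / 2) : ℂ) = 1 := by
      rw [← Complex.ofReal_mul, ← Real.exp_add, neg_add_cancel, Real.exp_zero, Complex.ofReal_one]
    unfold finTorusSliceKernel
    rw [Complex.ofReal_mul, Complex.ofReal_mul]
    calc (Real.exp (-(β * finTorusSpatialAction ρ a / 2)) : ℂ) *
          ((∫ g, Real.exp (-(β * finTorusTemporalAction ρ a g b))
            ∂(Measure.pi fun _ : FinSpatialSite b₁ b₂ b₃ => haarProbability G) : ℝ) : ℂ) *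
          (Real.exp (-(β * finTorusSpatialAction ρ b / 2)) : ℂ) *
          ((Real.exp (β * finTorusSpatialAction ρ b / 2) : ℂ) * (ρ (finSlicePolyakovHolonomy b q)).trace)
        = (Real.exp (-(β * finTorusSpatialAction ρ a / 2)) : ℂ) *
          ((∫ g, Real.exp (-(β * finTorusTemporalAction ρ a g b))
            ∂(Measure.pi fun _ : FinSpatialSite b₁ b₂ b₃ => haarProbability G) : ℝ) : ℂ) *
          ((Real.exp (-(β * finTorusSpatialAction ρ b / 2)) : ℂ) * (Real.exp (β * finTorusSpatialAction ρ b / 2) : ℂ)) *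
          (ρ (finSlicePolyakovHolonomy b q)).trace := by ring
      _ = _ := by rw [hcancel]; ring
  simp_rw [h1]
  rw [integral_const_mul, integral_integral_exp_neg_finTorusTemporalAction_mul ρ hρ β hvc hvg a]
  congr 1
  refine integral_congr_ae (Eventually.of_forall fun b => ?_)
  dsimp only
  rw [exp_neg_finTorusTemporalAction_one_eq_prod, Complex.ofReal_prod]

/-- ★ **The Polyakov witness survives one transfer step**: for `β > 0` and `N ≥ 1`, the function
`a ↦ ∫ K_β(a, b) u(b) db` is continuous and non-zero at the slice `(g on the first link of the line, 1 elsewhere)` for a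
suitable `g ∈ G` (`integral_prod_oneLinkWeight_mul_trace_polyakov`, `exists_trace_oneLinkMatrix_pow_mul_rep_ne_zero`),
hence NOT almost everywhere zero (Haar measure charges open sets) — `A(C)|0⟩ ≠ 0` in the Gauss-law projected space.
[cite: tHooft1979Flux, §4 (4.6)–(4.10)] [cite: MontvayMunster1994, §3.2.8 (3.184)–(3.187)] -/
theorem not_ae_eq_zero_integral_finTorusSliceKernel_mul_polyakovWitness (hρ : Continuous ρ)
    (hρu : ∀ g, ρ g ∈ Matrix.unitaryGroup (Fin N) ℂ) [NeZero N] [NeZero b₁] {β : ℝ} (hβ : 0 < β)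
    (q : Fin b₂ × Fin b₃) :
    ¬ ((fun a : FinSpatialSite b₁ b₂ b₃ × Fin 3 → G => ∫ b, (finTorusSliceKernel ρ β a b : ℂ) *
        ((Real.exp (β * finTorusSpatialAction ρ b / 2) : ℂ) * (ρ (finSlicePolyakovHolonomy b q)).trace)
        ∂(Measure.pi fun _ : FinSpatialSite b₁ b₂ b₃ × Fin 3 => haarProbability G))
        =ᵐ[Measure.pi fun _ : FinSpatialSite b₁ b₂ b₃ × Fin 3 => haarProbability G] 0) := by
  set μS : Measure (FinSpatialSite b₁ b₂ b₃ × Fin 3 → G) := Measure.pi fun _ => haarProbability G with hμS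
  -- the special slice and the value there
  obtain ⟨g, hg⟩ := exists_trace_oneLinkMatrix_pow_mul_rep_ne_zero ρ hρ hρu hβ b₁
  set a₀ : FinSpatialSite b₁ b₂ b₃ × Fin 3 → G :=
    Function.update (1 : FinSpatialSite b₁ b₂ b₃ × Fin 3 → G) (((0 : Fin b₁), q.1, q.2), 0) g with ha₀
  have hne : (∫ b, (finTorusSliceKernel ρ β a₀ b : ℂ) *
      ((Real.exp (β * finTorusSpatialAction ρ b / 2) : ℂ) * (ρ (finSlicePolyakovHolonomy b q)).trace) ∂μS) ≠ 0 := by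
    rw [integral_finTorusSliceKernel_mul_polyakovWitness ρ hρ β q a₀, ha₀,
      integral_prod_oneLinkWeight_mul_trace_polyakov ρ hρ β q g]
    refine mul_ne_zero (Complex.ofReal_ne_zero.2 (Real.exp_pos _).ne') (mul_ne_zero (pow_ne_zero _ ?_) hg)
    exact Complex.ofReal_ne_zero.2 (integral_oneLinkWeight_pos ρ hρ β).ne'
  -- continuity of `κu`
  have huc := continuous_polyakovWitness (b₁ := b₁) ρ hρ β q
  obtain ⟨B, hB⟩ := isCompact_univ.exists_bound_of_continuousOn huc.continuousOn
  obtain ⟨C, hC⟩ := exists_norm_finTorusSliceKernel_le (b₁ := b₁) (b₂ := b₂) (b₃ := b₃) ρ hρ β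
  have hKc := continuous_uncurry_finTorusSliceKernel (b₁ := b₁) (b₂ := b₂) (b₃ := b₃) ρ hρ β
  have hC0 : 0 ≤ C := (norm_nonneg _).trans (hC 1 1)
  have hcont : Continuous fun a : FinSpatialSite b₁ b₂ b₃ × Fin 3 → G => ∫ b, (finTorusSliceKernel ρ β a b : ℂ) *
      ((Real.exp (β * finTorusSpatialAction ρ b / 2) : ℂ) * (ρ (finSlicePolyakovHolonomy b q)).trace) ∂μS := by
    refine continuous_of_dominated (bound := fun _ => C * B) (fun a => ?_) (fun a => Eventually.of_forall fun b => ?_)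
      (integrable_const _) (Eventually.of_forall fun b => ?_)
    · exact ((Complex.continuous_ofReal.comp (hKc.comp (continuous_const.prodMk continuous_id))).mul
        huc).aestronglyMeasurable
    · rw [norm_mul, Complex.norm_real]
      exact mul_le_mul (hC a b) (hB b (Set.mem_univ b)) (norm_nonneg _) hC0
    · exact (Complex.continuous_ofReal.comp (hKc.comp (continuous_id.prodMk continuous_const))).mul continuous_const
  intro hae
  have heq := (Continuous.ae_eq_iff_eq μS hcont continuous_const).1 hae
  exact hne (congrFun heq a₀)

end Witness

/-! ### Main theorem: the unit electric flux in the direction of the line is populated -/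

section Main

variable {G : Type*} [Group G] [TopologicalSpace G] [IsTopologicalGroup G] [CompactSpace G]
  [MeasurableSpace G] [BorelSpace G] [SecondCountableTopology G] {N : ℕ} (ρ : G →* Matrix (Fin N) (Fin N) ℂ)
  {Γ : Type*} [AddCommGroup Γ] [Fintype Γ]

/-- ★ **Every unit electric flux of a finite box is populated** ('t Hooft (4.10): the Polyakov ∕ 't Hooft loop creates
one unit of electric flux, and the created state is non-zero).  For `β > 0`, a continuous unitary `ρ : G →* U(N)`
(`N ≥ 1`) of a compact metrisable group, a box `b₁ × b₂ × b₃` with all sides `≥ 1`, a finite abelian group `Γ` of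
central temporal twists `φ` and the character `ψ` by which `ρ` sees the twist in direction `0` — `ρ(φ k 0) = ψ(k)·1`
for all `k` — the flux-`ψ` sector is populated: **`0 < Re Z_ψ(M+2)` for every `M`**.
[cite: tHooft1979Flux, §4 (4.6)–(4.10) and §5 (5.1)–(5.4)] [cite: MontvayMunster1994, §3.2.8 (3.184)–(3.187)] -/
theorem wilsonFinTorusFluxPartition_re_pos_of_unitFlux (hρ : Continuous ρ)
    (hρu : ∀ g, ρ g ∈ Matrix.unitaryGroup (Fin N) ℂ) [NeZero N] {β : ℝ} (hβ : 0 < β) {φ : Γ → Fin 4 → G}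
    (hφ0 : φ 0 = 1) (hφadd : ∀ k k', φ (k + k') = φ k * φ k')
    (hφc : ∀ k (i : Fin 3), φ k i.castSucc ∈ Subgroup.center G) {ψ : AddChar Γ ℂ}
    (hψ : ∀ k, ρ (φ k 0) = (ψ k) • (1 : Matrix (Fin N) (Fin N) ℂ)) (b₁ b₂ b₃ : ℕ) [NeZero b₁] [NeZero b₂]
    [NeZero b₃] (M : ℕ) :
    0 < (wilsonFinTorusFluxPartition ρ β φ ψ b₁ b₂ b₃ (M + 2)).re := by
  obtain ⟨C, A, s, hcnt, b, lam, i₀, hC, hA, hb, hlam, -, -⟩ :=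
    exists_eigenbasis_finTorusSliceKernel hρ hρu hβ.le b₁ b₂ b₃
  haveI : Countable s := hcnt
  have hK := stronglyMeasurable_uncurry_finTorusSliceKernel (b₁ := b₁) (b₂ := b₂) (b₃ := b₃) ρ hρ β
  have hsymm : ∀ x y : FinSpatialSite b₁ b₂ b₃ × Fin 3 → G,
      finTorusSliceKernel ρ β x y = finTorusSliceKernel ρ β y x := finTorusSliceKernel_symm ρ hρu β
  have hT0 : (finSliceTwist (φ 0) : (FinSpatialSite b₁ b₂ b₃ × Fin 3 → G) → _) = id := by
    rw [hφ0]; exact finSliceTwist_one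
  have hTadd : ∀ (k k' : Γ) (x : FinSpatialSite b₁ b₂ b₃ × Fin 3 → G),
      finSliceTwist (φ (k + k')) x = finSliceTwist (φ k) (finSliceTwist (φ k') x) := fun k k' x => by
    rw [finSliceTwist_finSliceTwist, hφadd]
  have hT : ∀ k : Γ, MeasurePreserving (finSliceTwist (φ k) : (FinSpatialSite b₁ b₂ b₃ × Fin 3 → G) → _)
      (Measure.pi fun _ => haarProbability G) (Measure.pi fun _ => haarProbability G) :=
    fun k => measurePreserving_finSliceTwist (φ k)
  -- the witness: the traced Polyakov loop through `q = (0, 0)` over the half spatial weight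
  set q : Fin b₂ × Fin b₃ := (0, 0) with hq
  have huc := continuous_polyakovWitness (b₁ := b₁) ρ hρ β q
  obtain ⟨B, hB⟩ := isCompact_univ.exists_bound_of_continuousOn huc.continuousOn
  have hcov : ∀ (k : Γ) (x : FinSpatialSite b₁ b₂ b₃ × Fin 3 → G),
      (Real.exp (β * finTorusSpatialAction ρ (finSliceTwist (φ k) x) / 2) : ℂ) *
          (ρ (finSlicePolyakovHolonomy (finSliceTwist (φ k) x) q)).trace =
        ψ k * ((Real.exp (β * finTorusSpatialAction ρ x / 2) : ℂ) * (ρ (finSlicePolyakovHolonomy x q)).trace) :=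
    fun k x => by
    rw [finTorusSpatialAction_finSliceTwist ρ (hφc k), trace_rep_finSlicePolyakovHolonomy_finSliceTwist ρ (hψ k)]
    ring
  have hκu := not_ae_eq_zero_integral_finTorusSliceKernel_mul_polyakovWitness (b₁ := b₁) ρ hρ hρu hβ q
  exact re_fluxSector_pos_of_covariant (T := fun k => finSliceTwist (φ k)) hK hC hsymm hA hb (fun i => (hlam i).1)
    hT hT0 hTadd (z := fun k n => wilsonFinTorusTwistedPartition ρ β (φ k) b₁ b₂ b₃ n)
    (fun k M => wilsonFinTorusTwistedPartition_eq_integral_iterate ρ hρ β (hφc k) b₁ b₂ b₃ M) ψ huc.measurable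
    (fun x => hB x (Set.mem_univ x)) hcov hκu M

/-- **The oppositely oriented line populates the opposite flux**: under the same hypotheses `0 < Re Z_{−ψ}(M+2)`
(the complex-conjugate witness has flux `−ψ`, `(−ψ)(k) = ψ(−k) = conj ψ(k)`).
[cite: tHooft1979Flux, §4 (4.6)–(4.10) and §5 (5.1)–(5.4)] -/
theorem wilsonFinTorusFluxPartition_re_pos_of_unitFlux_neg (hρ : Continuous ρ)
    (hρu : ∀ g, ρ g ∈ Matrix.unitaryGroup (Fin N) ℂ) [NeZero N] {β : ℝ} (hβ : 0 < β) {φ : Γ → Fin 4 → G}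
    (hφ0 : φ 0 = 1) (hφadd : ∀ k k', φ (k + k') = φ k * φ k')
    (hφc : ∀ k (i : Fin 3), φ k i.castSucc ∈ Subgroup.center G) {ψ : AddChar Γ ℂ}
    (hψ : ∀ k, ρ (φ k 0) = (ψ k) • (1 : Matrix (Fin N) (Fin N) ℂ)) (b₁ b₂ b₃ : ℕ) [NeZero b₁] [NeZero b₂]
    [NeZero b₃] (M : ℕ) :
    0 < (wilsonFinTorusFluxPartition ρ β φ (-ψ) b₁ b₂ b₃ (M + 2)).re := by
  obtain ⟨C, A, s, hcnt, b, lam, i₀, hC, hA, hb, hlam, -, -⟩ :=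
    exists_eigenbasis_finTorusSliceKernel hρ hρu hβ.le b₁ b₂ b₃
  haveI : Countable s := hcnt
  have hK := stronglyMeasurable_uncurry_finTorusSliceKernel (b₁ := b₁) (b₂ := b₂) (b₃ := b₃) ρ hρ β
  have hsymm : ∀ x y : FinSpatialSite b₁ b₂ b₃ × Fin 3 → G,
      finTorusSliceKernel ρ β x y = finTorusSliceKernel ρ β y x := finTorusSliceKernel_symm ρ hρu β
  have hT0 : (finSliceTwist (φ 0) : (FinSpatialSite b₁ b₂ b₃ × Fin 3 → G) → _) = id := by
    rw [hφ0]; exact finSliceTwist_one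
  have hTadd : ∀ (k k' : Γ) (x : FinSpatialSite b₁ b₂ b₃ × Fin 3 → G),
      finSliceTwist (φ (k + k')) x = finSliceTwist (φ k) (finSliceTwist (φ k') x) := fun k k' x => by
    rw [finSliceTwist_finSliceTwist, hφadd]
  have hT : ∀ k : Γ, MeasurePreserving (finSliceTwist (φ k) : (FinSpatialSite b₁ b₂ b₃ × Fin 3 → G) → _)
      (Measure.pi fun _ => haarProbability G) (Measure.pi fun _ => haarProbability G) :=
    fun k => measurePreserving_finSliceTwist (φ k)
  -- the conjugate witness
  set q : Fin b₂ × Fin b₃ := (0, 0) with hq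
  have huc := continuous_polyakovWitness (b₁ := b₁) ρ hρ β q
  have huc' : Continuous fun x : FinSpatialSite b₁ b₂ b₃ × Fin 3 → G =>
      conj ((Real.exp (β * finTorusSpatialAction ρ x / 2) : ℂ) * (ρ (finSlicePolyakovHolonomy x q)).trace) :=
    Complex.continuous_conj.comp huc
  obtain ⟨B, hB⟩ := isCompact_univ.exists_bound_of_continuousOn huc'.continuousOn
  have hcov : ∀ (k : Γ) (x : FinSpatialSite b₁ b₂ b₃ × Fin 3 → G),
      conj ((Real.exp (β * finTorusSpatialAction ρ (finSliceTwist (φ k) x) / 2) : ℂ) *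
          (ρ (finSlicePolyakovHolonomy (finSliceTwist (φ k) x) q)).trace) =
        (-ψ) k * conj ((Real.exp (β * finTorusSpatialAction ρ x / 2) : ℂ) * (ρ (finSlicePolyakovHolonomy x q)).trace) :=
    fun k x => by
    rw [finTorusSpatialAction_finSliceTwist ρ (hφc k), trace_rep_finSlicePolyakovHolonomy_finSliceTwist ρ (hψ k),
      show (-ψ) k = ψ (-k) from rfl, AddChar.map_neg_eq_conj]
    simp only [map_mul]
    ring
  have hκu := not_ae_eq_zero_integral_finTorusSliceKernel_mul_polyakovWitness (b₁ := b₁) ρ hρ hρu hβ q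
  have hκu' : ¬ ((fun a : FinSpatialSite b₁ b₂ b₃ × Fin 3 → G => ∫ y, (finTorusSliceKernel ρ β a y : ℂ) *
      conj ((Real.exp (β * finTorusSpatialAction ρ y / 2) : ℂ) * (ρ (finSlicePolyakovHolonomy y q)).trace)
      ∂(Measure.pi fun _ : FinSpatialSite b₁ b₂ b₃ × Fin 3 => haarProbability G))
      =ᵐ[Measure.pi fun _ : FinSpatialSite b₁ b₂ b₃ × Fin 3 => haarProbability G] 0) := by
    intro h
    apply hκu
    filter_upwards [h] with a ha
    have h1 : ∫ y, (finTorusSliceKernel ρ β a y : ℂ) *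
        conj ((Real.exp (β * finTorusSpatialAction ρ y / 2) : ℂ) * (ρ (finSlicePolyakovHolonomy y q)).trace)
        ∂(Measure.pi fun _ : FinSpatialSite b₁ b₂ b₃ × Fin 3 => haarProbability G) =
        conj (∫ y, (finTorusSliceKernel ρ β a y : ℂ) *
          ((Real.exp (β * finTorusSpatialAction ρ y / 2) : ℂ) * (ρ (finSlicePolyakovHolonomy y q)).trace)
          ∂(Measure.pi fun _ : FinSpatialSite b₁ b₂ b₃ × Fin 3 => haarProbability G)) := by
      rw [← integral_conj]
      refine integral_congr_ae (Eventually.of_forall fun y => ?_)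
      simp only [map_mul, Complex.conj_ofReal]
    rw [h1, Pi.zero_apply, map_eq_zero] at ha
    rw [ha, Pi.zero_apply]
  exact re_fluxSector_pos_of_covariant (T := fun k => finSliceTwist (φ k)) hK hC hsymm hA hb (fun i => (hlam i).1)
    hT hT0 hTadd (z := fun k n => wilsonFinTorusTwistedPartition ρ β (φ k) b₁ b₂ b₃ n)
    (fun k M => wilsonFinTorusTwistedPartition_eq_integral_iterate ρ hρ β (hφc k) b₁ b₂ b₃ M) (-ψ) huc'.measurable
    (fun x => hB x (Set.mem_univ x)) hcov hκu' M

/-! ### Consequences: the flux energy of a unit flux is unconditionally defined and positive -/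

/-- ★ **'t Hooft's flux energy of a unit electric flux exists unconditionally**: under the hypotheses of
`wilsonFinTorusFluxPartition_re_pos_of_unitFlux`, `(1/M) · log (Re Z_0(M+2) / Re Z_ψ(M+2)) → E_ψ` as `M → ∞`
(`tendsto_wilsonFinTorusFluxEnergy` with its population hypothesis discharged).
[cite: tHooft1979Flux, §4 (4.10) and §5 after (5.4)] [cite: Greensite2011, §4.4 (4.41)–(4.44)] -/
theorem tendsto_wilsonFinTorusFluxEnergy_of_unitFlux (hρ : Continuous ρ)
    (hρu : ∀ g, ρ g ∈ Matrix.unitaryGroup (Fin N) ℂ) [NeZero N] {β : ℝ} (hβ : 0 < β) {φ : Γ → Fin 4 → G}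
    (hφ0 : φ 0 = 1) (hφadd : ∀ k k', φ (k + k') = φ k * φ k')
    (hφc : ∀ k (i : Fin 3), φ k i.castSucc ∈ Subgroup.center G) {ψ : AddChar Γ ℂ}
    (hψ : ∀ k, ρ (φ k 0) = (ψ k) • (1 : Matrix (Fin N) (Fin N) ℂ)) (b₁ b₂ b₃ : ℕ) [NeZero b₁] [NeZero b₂]
    [NeZero b₃] :
    Tendsto (fun M : ℕ => Real.log ((wilsonFinTorusFluxPartition ρ β φ 0 b₁ b₂ b₃ (M + 2)).re /
        (wilsonFinTorusFluxPartition ρ β φ ψ b₁ b₂ b₃ (M + 2)).re) / M) atTop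
      (𝓝 (wilsonFinTorusFluxEnergy ρ β φ ψ b₁ b₂ b₃)) :=
  tendsto_wilsonFinTorusFluxEnergy ρ hρ hρu hβ.le hφ0 hφadd hφc b₁ b₂ b₃
    (wilsonFinTorusFluxPartition_re_pos_of_unitFlux ρ hρ hρu hβ hφ0 hφadd hφc hψ b₁ b₂ b₃ 1)

/-- ★ **A unit electric flux costs at least the finite-volume gap, unconditionally**: for `ψ ≠ 0`,
`−log tanh(3Nβ·b₁b₂b₃) ≤ E_ψ` (`neg_log_tanh_le_wilsonFinTorusFluxEnergy` with its population hypothesis discharged).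
[cite: tHooft1979Flux, §4 (4.10) and §5 after (5.4)] [cite: Hopf1963, Thm 4] -/
theorem neg_log_tanh_le_wilsonFinTorusFluxEnergy_of_unitFlux (hρ : Continuous ρ)
    (hρu : ∀ g, ρ g ∈ Matrix.unitaryGroup (Fin N) ℂ) [NeZero N] {β : ℝ} (hβ : 0 < β) {φ : Γ → Fin 4 → G}
    (hφ0 : φ 0 = 1) (hφadd : ∀ k k', φ (k + k') = φ k * φ k')
    (hφc : ∀ k (i : Fin 3), φ k i.castSucc ∈ Subgroup.center G) {ψ : AddChar Γ ℂ} (hψ0 : ψ ≠ 0)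
    (hψ : ∀ k, ρ (φ k 0) = (ψ k) • (1 : Matrix (Fin N) (Fin N) ℂ)) (b₁ b₂ b₃ : ℕ) [NeZero b₁] [NeZero b₂]
    [NeZero b₃] :
    -Real.log (Real.tanh (3 * N * β * ((b₁ : ℝ) * b₂ * b₃))) ≤ wilsonFinTorusFluxEnergy ρ β φ ψ b₁ b₂ b₃ :=
  neg_log_tanh_le_wilsonFinTorusFluxEnergy ρ hρ hρu hβ.le hφ0 hφadd hφc b₁ b₂ b₃ hψ0
    (wilsonFinTorusFluxPartition_re_pos_of_unitFlux ρ hρ hρu hβ hφ0 hφadd hφc hψ b₁ b₂ b₃ 1)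

/-- ★ **Every unit electric flux of a finite box has strictly positive energy, unconditionally**: `0 < E_ψ` for
`ψ ≠ 0` (`wilsonFinTorusFluxEnergy_pos` with its population hypothesis discharged).  A ONE-BOX statement: the bound
degenerates exponentially in the spatial volume; nothing about `E_ψ` as the box grows ('t Hooft §7).
[cite: tHooft1979Flux, §4 (4.10) and §5 after (5.4)] [cite: Hopf1963, Thm 4] -/
theorem wilsonFinTorusFluxEnergy_pos_of_unitFlux (hρ : Continuous ρ)
    (hρu : ∀ g, ρ g ∈ Matrix.unitaryGroup (Fin N) ℂ) [NeZero N] {β : ℝ} (hβ : 0 < β) {φ : Γ → Fin 4 → G}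
    (hφ0 : φ 0 = 1) (hφadd : ∀ k k', φ (k + k') = φ k * φ k')
    (hφc : ∀ k (i : Fin 3), φ k i.castSucc ∈ Subgroup.center G) {ψ : AddChar Γ ℂ} (hψ0 : ψ ≠ 0)
    (hψ : ∀ k, ρ (φ k 0) = (ψ k) • (1 : Matrix (Fin N) (Fin N) ℂ)) (b₁ b₂ b₃ : ℕ) [NeZero b₁] [NeZero b₂]
    [NeZero b₃] :
    0 < wilsonFinTorusFluxEnergy ρ β φ ψ b₁ b₂ b₃ :=
  wilsonFinTorusFluxEnergy_pos ρ hρ hρu hβ.le hφ0 hφadd hφc b₁ b₂ b₃ hψ0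
    (wilsonFinTorusFluxPartition_re_pos_of_unitFlux ρ hρ hρu hβ hφ0 hφadd hφc hψ b₁ b₂ b₃ 1)

end Main

/-!
## Part II.  Every electric flux: several Polyakov lines, along all three axes

't Hooft (4.10): «the integers `e_i` count how many times an operator of the form `A(C)` acted in the various
directions».  Acting with `n₀` traced Polyakov loops along axis `0` (at distinct transverse positions), `n₁` along axis
`1` and `n₂` along axis `2` on the flux-free vacuum creates the flux `n₀ψ₀ + n₁ψ₁ + n₂ψ₂` (`ψ_i` the character by which
`ρ` sees the temporal twist of direction `i`); the created state survives one transfer step by the same one-link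
computation as for a single line, done for an arbitrary finite family of pairwise link-disjoint lines
(`integral_prod_oneLinkWeight_mul_prod_trace_lines`: the links of distinct lines are independent under the product
Haar measure).
-/

/-! ### Polyakov holonomies of a slice along its second and third axes -/

section PolyakovAxes

variable {b₁ b₂ b₃ : ℕ} {G : Type*} [Group G]

/-- **The Polyakov (Wilson-line) holonomy of a spatial slice along its SECOND axis** at transverse position
`q = (q₀, q₂)`: the ordered product `a((q₀,0,q₂),1) a((q₀,1,q₂),1) ⋯ a((q₀,b₂−1,q₂),1)` of the `b₂` links of direction `1`
on the closed straight line `{(q₀, k, q₂)}_k` (companion of `finSlicePolyakovHolonomy`, which is the line along the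
first axis). [cite: BorgsSeiler1983, §II.3 Lemma II.4 and Remark 1 (p. 336)] [cite: tHooft1979Flux, §4 (4.6)] -/
def finSlicePolyakovHolonomy₁ (a : FinSpatialSite b₁ b₂ b₃ × Fin 3 → G) (q : Fin b₁ × Fin b₃) : G :=
  (List.ofFn fun k : Fin b₂ => a ((q.1, k, q.2), 1)).prod

/-- **The Polyakov (Wilson-line) holonomy of a spatial slice along its THIRD axis** at transverse position
`q = (q₀, q₁)`: the ordered product of the `b₃` links of direction `2` on the closed straight line `{(q₀, q₁, k)}_k`.
[cite: BorgsSeiler1983, §II.3 Lemma II.4 and Remark 1 (p. 336)] [cite: tHooft1979Flux, §4 (4.6)] -/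
def finSlicePolyakovHolonomy₂ (a : FinSpatialSite b₁ b₂ b₃ × Fin 3 → G) (q : Fin b₁ × Fin b₂) : G :=
  (List.ofFn fun k : Fin b₃ => a ((q.1, q.2, k), 2)).prod

/-- Unfolding lemma. [cite: BorgsSeiler1983, §II.3 Lemma II.4 (p. 336)] -/
theorem finSlicePolyakovHolonomy₁_def (a : FinSpatialSite b₁ b₂ b₃ × Fin 3 → G) (q : Fin b₁ × Fin b₃) :
    finSlicePolyakovHolonomy₁ a q = (List.ofFn fun k : Fin b₂ => a ((q.1, k, q.2), 1)).prod := rfl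

/-- Unfolding lemma. [cite: BorgsSeiler1983, §II.3 Lemma II.4 (p. 336)] -/
theorem finSlicePolyakovHolonomy₂_def (a : FinSpatialSite b₁ b₂ b₃ × Fin 3 → G) (q : Fin b₁ × Fin b₂) :
    finSlicePolyakovHolonomy₂ a q = (List.ofFn fun k : Fin b₃ => a ((q.1, q.2, k), 2)).prod := rfl

/-- The twist factor on the links of direction `1`: `z 1` on the sheet `{p₁ = 0}`, `1` elsewhere.
[cite: tHooft1979Flux, §4 (4.2)] -/
private theorem finSliceTwist_apply_dir_one (z : Fin 4 → G) (a : FinSpatialSite b₁ b₂ b₃ × Fin 3 → G)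
    (q : Fin b₁ × Fin b₃) (k : Fin b₂) :
    finSliceTwist z a ((q.1, k, q.2), 1) = (if (k : ℕ) = 0 then z 1 else 1) * a ((q.1, k, q.2), 1) := by
  have h1 : finSpatialCoord ((q.1, k, q.2) : FinSpatialSite b₁ b₂ b₃) 1 = (k : ℕ) := rfl
  have h2 : ((1 : Fin 3).castSucc : Fin 4) = 1 := rfl
  simp only [finSliceTwist, finSliceTwistFactor, h1, h2]

/-- The twist factor on the links of direction `2`: `z 2` on the sheet `{p₂ = 0}`, `1` elsewhere.
[cite: tHooft1979Flux, §4 (4.2)] -/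
private theorem finSliceTwist_apply_dir_two (z : Fin 4 → G) (a : FinSpatialSite b₁ b₂ b₃ × Fin 3 → G)
    (q : Fin b₁ × Fin b₂) (k : Fin b₃) :
    finSliceTwist z a ((q.1, q.2, k), 2) = (if (k : ℕ) = 0 then z 2 else 1) * a ((q.1, q.2, k), 2) := by
  have h1 : finSpatialCoord ((q.1, q.2, k) : FinSpatialSite b₁ b₂ b₃) 2 = (k : ℕ) := rfl
  have h2 : ((2 : Fin 3).castSucc : Fin 4) = 2 := rfl
  simp only [finSliceTwist, finSliceTwistFactor, h1, h2]

/-- **Centre charge of the axis-`1` Polyakov holonomy under the slice twist**: exactly one link of the line — the one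
leaving the sheet `{p₁ = 0}` — is multiplied by `z 1`, so `P¹_q(T_z a) = z 1 · P¹_q(a)` (any `z`; `b₂ ≥ 1`).
[cite: tHooft1979Flux, §4 (4.6)–(4.8)] -/
theorem finSlicePolyakovHolonomy₁_finSliceTwist [NeZero b₂] (z : Fin 4 → G)
    (a : FinSpatialSite b₁ b₂ b₃ × Fin 3 → G) (q : Fin b₁ × Fin b₃) :
    finSlicePolyakovHolonomy₁ (finSliceTwist z a) q = z 1 * finSlicePolyakovHolonomy₁ a q := by
  obtain ⟨k, hk⟩ := Nat.exists_eq_succ_of_ne_zero (NeZero.ne b₂)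
  subst hk
  unfold finSlicePolyakovHolonomy₁
  rw [List.ofFn_succ, List.ofFn_succ, List.prod_cons, List.prod_cons, finSliceTwist_apply_dir_one, mul_assoc]
  simp only [Fin.val_zero, if_true]
  congr 2
  refine congrArg List.prod (List.ofFn_inj.mpr (funext fun i => ?_))
  rw [finSliceTwist_apply_dir_one]
  simp [Fin.val_succ]

/-- **Centre charge of the axis-`2` Polyakov holonomy under the slice twist**: `P²_q(T_z a) = z 2 · P²_q(a)`.
[cite: tHooft1979Flux, §4 (4.6)–(4.8)] -/
theorem finSlicePolyakovHolonomy₂_finSliceTwist [NeZero b₃] (z : Fin 4 → G)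
    (a : FinSpatialSite b₁ b₂ b₃ × Fin 3 → G) (q : Fin b₁ × Fin b₂) :
    finSlicePolyakovHolonomy₂ (finSliceTwist z a) q = z 2 * finSlicePolyakovHolonomy₂ a q := by
  obtain ⟨k, hk⟩ := Nat.exists_eq_succ_of_ne_zero (NeZero.ne b₃)
  subst hk
  unfold finSlicePolyakovHolonomy₂
  rw [List.ofFn_succ, List.ofFn_succ, List.prod_cons, List.prod_cons, finSliceTwist_apply_dir_two, mul_assoc]
  simp only [Fin.val_zero, if_true]
  congr 2
  refine congrArg List.prod (List.ofFn_inj.mpr (funext fun i => ?_))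
  rw [finSliceTwist_apply_dir_two]
  simp [Fin.val_succ]

/-- **Gauge covariance of the axis-`1` holonomy**: `P¹_q(x^c) = c_{(q₀,0,q₂)} P¹_q(x) c_{(q₀,0,q₂)}⁻¹` (telescoping
around the periodic direction). [cite: BorgsSeiler1983, §II.3 Lemma II.4 (p. 336)] -/
theorem finSlicePolyakovHolonomy₁_finSliceGaugeTransform [NeZero b₂] (c : FinSpatialSite b₁ b₂ b₃ → G)
    (x : FinSpatialSite b₁ b₂ b₃ × Fin 3 → G) (q : Fin b₁ × Fin b₃) :
    finSlicePolyakovHolonomy₁ (finSliceGaugeTransform c x) q =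
      c (q.1, 0, q.2) * finSlicePolyakovHolonomy₁ x q * (c (q.1, 0, q.2))⁻¹ := by
  obtain ⟨m, hm⟩ := Nat.exists_eq_succ_of_ne_zero (NeZero.ne b₂)
  subst hm
  unfold finSlicePolyakovHolonomy₁
  have h : (fun k : Fin (m + 1) => finSliceGaugeTransform c x ((q.1, k, q.2), 1)) =
      fun k => (fun k' : Fin (m + 1) => c (q.1, k', q.2)) k * x ((q.1, k, q.2), 1) *
        ((fun k' : Fin (m + 1) => c (q.1, k', q.2)) (finRotate (m + 1) k))⁻¹ := by
    funext k
    rfl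
  rw [h, prod_ofFn_mul_mul_inv_finRotate]

/-- **Gauge covariance of the axis-`2` holonomy**: `P²_q(x^c) = c_{(q₀,q₁,0)} P²_q(x) c_{(q₀,q₁,0)}⁻¹`.
[cite: BorgsSeiler1983, §II.3 Lemma II.4 (p. 336)] -/
theorem finSlicePolyakovHolonomy₂_finSliceGaugeTransform [NeZero b₃] (c : FinSpatialSite b₁ b₂ b₃ → G)
    (x : FinSpatialSite b₁ b₂ b₃ × Fin 3 → G) (q : Fin b₁ × Fin b₂) :
    finSlicePolyakovHolonomy₂ (finSliceGaugeTransform c x) q =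
      c (q.1, q.2, 0) * finSlicePolyakovHolonomy₂ x q * (c (q.1, q.2, 0))⁻¹ := by
  obtain ⟨m, hm⟩ := Nat.exists_eq_succ_of_ne_zero (NeZero.ne b₃)
  subst hm
  unfold finSlicePolyakovHolonomy₂
  have h : (fun k : Fin (m + 1) => finSliceGaugeTransform c x ((q.1, q.2, k), 2)) =
      fun k => (fun k' : Fin (m + 1) => c (q.1, q.2, k')) k * x ((q.1, q.2, k), 2) *
        ((fun k' : Fin (m + 1) => c (q.1, q.2, k')) (finRotate (m + 1) k))⁻¹ := by
    funext k
    rfl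
  rw [h, prod_ofFn_mul_mul_inv_finRotate]

variable {N : ℕ} (ρ : G →* Matrix (Fin N) (Fin N) ℂ)

/-- The traced axis-`1` loop acquires the centre character: `tr ρ(P¹_q(T_z a)) = ω · tr ρ(P¹_q(a))` if `ρ(z 1) = ω·1`.
[cite: tHooft1979Flux, §4 (4.8)–(4.9)] -/
theorem trace_rep_finSlicePolyakovHolonomy₁_finSliceTwist [NeZero b₂] {z : Fin 4 → G} {ω : ℂ}
    (hω : ρ (z 1) = ω • (1 : Matrix (Fin N) (Fin N) ℂ)) (a : FinSpatialSite b₁ b₂ b₃ × Fin 3 → G)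
    (q : Fin b₁ × Fin b₃) :
    (ρ (finSlicePolyakovHolonomy₁ (finSliceTwist z a) q)).trace = ω * (ρ (finSlicePolyakovHolonomy₁ a q)).trace := by
  rw [finSlicePolyakovHolonomy₁_finSliceTwist, map_mul, hω, smul_mul_assoc, one_mul, Matrix.trace_smul, smul_eq_mul]

/-- The traced axis-`2` loop acquires the centre character: `tr ρ(P²_q(T_z a)) = ω · tr ρ(P²_q(a))` if `ρ(z 2) = ω·1`.
[cite: tHooft1979Flux, §4 (4.8)–(4.9)] -/
theorem trace_rep_finSlicePolyakovHolonomy₂_finSliceTwist [NeZero b₃] {z : Fin 4 → G} {ω : ℂ}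
    (hω : ρ (z 2) = ω • (1 : Matrix (Fin N) (Fin N) ℂ)) (a : FinSpatialSite b₁ b₂ b₃ × Fin 3 → G)
    (q : Fin b₁ × Fin b₂) :
    (ρ (finSlicePolyakovHolonomy₂ (finSliceTwist z a) q)).trace = ω * (ρ (finSlicePolyakovHolonomy₂ a q)).trace := by
  rw [finSlicePolyakovHolonomy₂_finSliceTwist, map_mul, hω, smul_mul_assoc, one_mul, Matrix.trace_smul, smul_eq_mul]

/-- The traced axis-`1` loop is gauge invariant. [cite: BorgsSeiler1983, §II.3 Lemma II.4 (p. 336)] -/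
theorem trace_rep_finSlicePolyakovHolonomy₁_finSliceGaugeTransform [NeZero b₂] (c : FinSpatialSite b₁ b₂ b₃ → G)
    (x : FinSpatialSite b₁ b₂ b₃ × Fin 3 → G) (q : Fin b₁ × Fin b₃) :
    (ρ (finSlicePolyakovHolonomy₁ (finSliceGaugeTransform c x) q)).trace = (ρ (finSlicePolyakovHolonomy₁ x q)).trace := by
  rw [finSlicePolyakovHolonomy₁_finSliceGaugeTransform, CompactGroup.trace_conj_eq ρ]

/-- The traced axis-`2` loop is gauge invariant. [cite: BorgsSeiler1983, §II.3 Lemma II.4 (p. 336)] -/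
theorem trace_rep_finSlicePolyakovHolonomy₂_finSliceGaugeTransform [NeZero b₃] (c : FinSpatialSite b₁ b₂ b₃ → G)
    (x : FinSpatialSite b₁ b₂ b₃ × Fin 3 → G) (q : Fin b₁ × Fin b₂) :
    (ρ (finSlicePolyakovHolonomy₂ (finSliceGaugeTransform c x) q)).trace = (ρ (finSlicePolyakovHolonomy₂ x q)).trace := by
  rw [finSlicePolyakovHolonomy₂_finSliceGaugeTransform, CompactGroup.trace_conj_eq ρ]

variable [TopologicalSpace G] [IsTopologicalGroup G]

/-- Continuity of the axis-`1` holonomy in the slice (a finite ordered product of coordinates).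
[cite: BorgsSeiler1983, §II.3 Lemma II.4 (p. 336)] -/
theorem continuous_finSlicePolyakovHolonomy₁ (q : Fin b₁ × Fin b₃) :
    Continuous fun a : FinSpatialSite b₁ b₂ b₃ × Fin 3 → G => finSlicePolyakovHolonomy₁ a q :=
  continuous_prod_ofFn' (fun (k : Fin b₂) (a : FinSpatialSite b₁ b₂ b₃ × Fin 3 → G) => a ((q.1, k, q.2), 1))
    fun _ => continuous_apply _

/-- Continuity of the axis-`2` holonomy in the slice (a finite ordered product of coordinates).
[cite: BorgsSeiler1983, §II.3 Lemma II.4 (p. 336)] -/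
theorem continuous_finSlicePolyakovHolonomy₂ (q : Fin b₁ × Fin b₂) :
    Continuous fun a : FinSpatialSite b₁ b₂ b₃ × Fin 3 → G => finSlicePolyakovHolonomy₂ a q :=
  continuous_prod_ofFn' (fun (k : Fin b₃) (a : FinSpatialSite b₁ b₂ b₃ × Fin 3 → G) => a ((q.1, q.2, k), 2))
    fun _ => continuous_apply _

end PolyakovAxes

/-! ### Independent link blocks under the product Haar measure; the loop integral for several lines -/

section Lines

variable {G : Type*} [Group G] {N : ℕ} (ρ : G →* Matrix (Fin N) (Fin N) ℂ)

variable [TopologicalSpace G] [IsTopologicalGroup G] [CompactSpace G] [MeasurableSpace G] [BorelSpace G]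
  [SecondCountableTopology G]

omit [SecondCountableTopology G] in
/-- **Disjoint blocks of links are independent under the product Haar measure**: if `Ψ` does not depend on the
links of the block `p` and `F` depends only on them, `∫ F(x|_p) Ψ(x) dx = (∫ F) · (∫ Ψ)` (Fubini for the splitting
`G^ι ≃ G^p × G^{¬p}`; the Haar measure is a probability measure). [cite: MontvayMunster1994, §3.2.8 (3.184)] -/
private theorem integral_mul_eq_integral_mul_integral_of_indep {ι : Type*} [Fintype ι] [DecidableEq ι]
    (p : ι → Prop) [DecidablePred p] (F : ({l // p l} → G) → ℂ) (Ψ : (ι → G) → ℂ)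
    (hΨ : ∀ x x' : ι → G, (∀ l, ¬ p l → x l = x' l) → Ψ x = Ψ x') :
    ∫ x, F (fun l => x l) * Ψ x ∂(Measure.pi fun _ : ι => haarProbability G) =
      (∫ y, F y ∂(Measure.pi fun _ : {l // p l} => haarProbability G)) *
        ∫ x, Ψ x ∂(Measure.pi fun _ : ι => haarProbability G) := by
  set μ := haarProbability G with hμ
  set e₀ := MeasurableEquiv.piEquivPiSubtypeProd (fun _ : ι => G) p with he₀
  have hmp : MeasurePreserving e₀ (Measure.pi fun _ => μ)
      ((Measure.pi fun _ : {l // p l} => μ).prod (Measure.pi fun _ : {l // ¬ p l} => μ)) :=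
    measurePreserving_piEquivPiSubtypeProd (fun _ => μ) p
  have he₀p : ∀ (z : ({l // p l} → G) × ({l // ¬ p l} → G)) (l : {l // p l}),
      e₀.symm z (l : ι) = z.1 l := fun z l => by
    simp [he₀, MeasurableEquiv.piEquivPiSubtypeProd, Equiv.piEquivPiSubtypeProd, l.2]
  have he₀n : ∀ (z : ({l // p l} → G) × ({l // ¬ p l} → G)) (l : {l // ¬ p l}),
      e₀.symm z (l : ι) = z.2 l := fun z l => by
    simp [he₀, MeasurableEquiv.piEquivPiSubtypeProd, Equiv.piEquivPiSubtypeProd, l.2]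
  -- through the splitting, `Ψ` is a function of the second component and `F` of the first
  set Ψ₂ : ({l // ¬ p l} → G) → ℂ := fun w => Ψ (e₀.symm (fun _ => 1, w)) with hΨ₂
  have hΨz : ∀ z : ({l // p l} → G) × ({l // ¬ p l} → G), Ψ (e₀.symm z) = Ψ₂ z.2 := fun z =>
    hΨ _ _ fun l hl => by rw [he₀n z ⟨l, hl⟩, he₀n (fun _ => 1, z.2) ⟨l, hl⟩]
  have hFz : ∀ z : ({l // p l} → G) × ({l // ¬ p l} → G),
      F (fun l => e₀.symm z (l : ι)) = F z.1 := fun z => by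
    congr 1
    funext l
    exact he₀p z l
  have hΨint : ∫ x, Ψ x ∂(Measure.pi fun _ : ι => μ) =
      ∫ w, Ψ₂ w ∂(Measure.pi fun _ : {l // ¬ p l} => μ) := by
    rw [← (hmp.symm e₀).integral_comp']
    simp_rw [hΨz]
    rw [integral_fun_snd]
    simp
  rw [← (hmp.symm e₀).integral_comp']
  simp_rw [hFz, hΨz]
  rw [integral_prod_mul F Ψ₂, hΨint]

omit [SecondCountableTopology G] in
/-- A block of one-link weights integrates to `H^{#block}`, `H = ∫ f_β` (any shifts `a`; plumbing).
[cite: MontvayMunster1994, §3.2.8 (3.184)] -/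
private theorem integral_prod_oneLinkWeight_eq_pow (hρ : Continuous ρ) (β : ℝ) {ι' : Type*} [Fintype ι']
    (a : ι' → G) :
    ∫ y : ι' → G, ∏ l, (oneLinkWeight ρ β (a l * (y l)⁻¹) : ℂ) ∂(Measure.pi fun _ => haarProbability G) =
      ((∫ x, oneLinkWeight ρ β x ∂haarProbability G : ℝ) : ℂ) ^ Fintype.card ι' := by
  rw [integral_fintype_prod_eq_prod (fun (l : ι') (x : G) => (oneLinkWeight ρ β (a l * x⁻¹) : ℂ))]
  have h1 : ∀ l : ι', ∫ x, (oneLinkWeight ρ β (a l * x⁻¹) : ℂ) ∂haarProbability G =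
      ((∫ x, oneLinkWeight ρ β x ∂haarProbability G : ℝ) : ℂ) := fun l => by
    rw [integral_complex_ofReal, integral_oneLinkWeight_mul_inv ρ hρ β]
  simp_rw [h1]
  rw [Finset.prod_const, Finset.card_univ]

/-- **The integral over one block of links carrying an ordered product**: for an enumeration `eqv` of the block,
`∫ ∏_{l ∈ block} f_β(a_l y_l⁻¹) · tr ρ(y_{eqv 0} ⋯ y_{eqv (m−1)}) ∏ dy = tr(∏_k M(β) ρ(a_{eqv k}))` (transport to
`Fin m` and the chain lemma). [cite: MontvayMunster1994, §3.2.8 (3.184)–(3.187)] -/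
private theorem integral_block_trace (hρ : Continuous ρ) (β : ℝ) {ι : Type*} [Fintype ι]
    (p : ι → Prop) [DecidablePred p] {m : ℕ} (eqv : Fin m ≃ {l // p l}) (a : ι → G) :
    ∫ y : {l // p l} → G, (∏ l : {l // p l}, (oneLinkWeight ρ β (a l * (y l)⁻¹) : ℂ)) *
        (ρ (List.ofFn fun k => y (eqv k)).prod).trace ∂(Measure.pi fun _ => haarProbability G) =
      ((List.ofFn fun k => oneLinkMatrix ρ β * ρ (a (eqv k))).prod).trace := by
  set μ := haarProbability G with hμ
  set eL := MeasurableEquiv.piCongrLeft (fun _ : {l // p l} => G) eqv with heL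
  have hmL : MeasurePreserving eL (Measure.pi fun _ : Fin m => μ) (Measure.pi fun _ : {l // p l} => μ) :=
    measurePreserving_piCongrLeft (fun _ : {l // p l} => μ) eqv
  rw [← hmL.integral_comp']
  have heLk : ∀ (y : Fin m → G) (k : Fin m), eL y (eqv k) = y k := fun y k => by
    rw [heL, MeasurableEquiv.coe_piCongrLeft, Equiv.piCongrLeft_apply_apply]
  have hFLy : ∀ y : Fin m → G, (∏ l : {l // p l}, (oneLinkWeight ρ β (a l * (eL y l)⁻¹) : ℂ)) *
        (ρ (List.ofFn fun k => eL y (eqv k)).prod).trace =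
      (∏ k : Fin m, (oneLinkWeight ρ β (a (eqv k) * (y k)⁻¹) : ℂ)) *
        ((1 : Matrix (Fin N) (Fin N) ℂ) * (List.ofFn fun k : Fin m => ρ (y k)).prod).trace := fun y => by
    have h1 : (∏ l : {l // p l}, (oneLinkWeight ρ β (a l * (eL y l)⁻¹) : ℂ)) =
        ∏ k : Fin m, (oneLinkWeight ρ β (a (eqv k) * (y k)⁻¹) : ℂ) := by
      refine (Fintype.prod_equiv eqv _ _ fun k => ?_).symm
      rw [heLk]
    have h2 : (List.ofFn fun k : Fin m => eL y (eqv k)) = List.ofFn fun k => y k :=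
      List.ofFn_inj.mpr (funext fun k => heLk y k)
    rw [h1, h2, Matrix.one_mul, map_list_prod, List.map_ofFn]
    rfl
  simp_rw [hFLy]
  have hmt : ∀ y : Fin m → G, (∏ k : Fin m, (oneLinkWeight ρ β (a (eqv k) * (y k)⁻¹) : ℂ)) *
      ((1 : Matrix (Fin N) (Fin N) ℂ) * (List.ofFn fun k : Fin m => ρ (y k)).prod).trace =
      ∑ i, (∏ k : Fin m, (oneLinkWeight ρ β (a (eqv k) * (y k)⁻¹) : ℂ)) *
        ((1 : Matrix (Fin N) (Fin N) ℂ) * (List.ofFn fun k : Fin m => ρ (y k)).prod) i i := fun y => by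
    rw [Matrix.trace, Finset.mul_sum]
    rfl
  simp_rw [hmt]
  have hinti : ∀ i : Fin N, Integrable (fun y : Fin m → G =>
      (∏ k : Fin m, (oneLinkWeight ρ β (a (eqv k) * (y k)⁻¹) : ℂ)) *
        ((1 : Matrix (Fin N) (Fin N) ℂ) * (List.ofFn fun k : Fin m => ρ (y k)).prod) i i)
      (Measure.pi fun _ : Fin m => μ) := fun i =>
    integrable_of_continuous_cpt' ((continuous_finsetProd _ fun k _ =>
      (Complex.continuous_ofReal.comp (continuous_oneLinkWeight ρ hρ β)).comp
        (continuous_const.mul (continuous_apply k).inv)).mul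
      (Continuous.matrix_elem (continuous_const.matrix_mul (continuous_prod_ofFn'
        (fun (k : Fin m) (y : Fin m → G) => ρ (y k)) fun k => hρ.comp (continuous_apply k))) i i))
  rw [integral_finsetSum _ fun i _ => hinti i]
  rw [Finset.sum_congr rfl fun i _ =>
    integral_prod_oneLinkWeight_mul_listProd_apply ρ hρ β m (fun k => a (eqv k)) 1 i i, Matrix.one_mul]
  rfl

/-- ★ **The loop integral for several pairwise link-disjoint lines.**  For a finite family `S` of lines
(`line L` a list of DISTINCT links, the lists of distinct members of `S` DISJOINT) and ANY slice `a`: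
`H^{Σ_{L∈S} |L|} · ∫ ∏_l f_β(a_l x_l⁻¹) · ∏_{L∈S} tr ρ(∏_{l∈L} x_l) dx = H^{#links} · ∏_{L∈S} tr(∏_{l∈L} M(β) ρ(a_l))`,
`H = ∫ f_β > 0`, `M(β) = ∫ f_β ρ` — each line integrates to its ordered product of one-link matrices, every other link to
`H` (induction on `S`: the links of one line are independent of the rest, `integral_mul_eq_integral_mul_integral_of_indep`).
[cite: MontvayMunster1994, §3.2.8 (3.184)–(3.187)] [cite: tHooft1979Flux, §4 (4.6)–(4.10)] -/
theorem integral_prod_oneLinkWeight_mul_prod_trace_lines (hρ : Continuous ρ) (β : ℝ) {ι : Type*} [Fintype ι]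
    [DecidableEq ι] {Λ : Type*} [DecidableEq Λ] (line : Λ → List ι) (S : Finset Λ)
    (hnd : ∀ L ∈ S, (line L).Nodup) (hdj : ∀ L ∈ S, ∀ L' ∈ S, L ≠ L' → (line L).Disjoint (line L'))
    (a : ι → G) :
    ((∫ x, oneLinkWeight ρ β x ∂haarProbability G : ℝ) : ℂ) ^ (∑ L ∈ S, (line L).length) *
        ∫ x : ι → G, (∏ l, (oneLinkWeight ρ β (a l * (x l)⁻¹) : ℂ)) *
          ∏ L ∈ S, (ρ ((line L).map x).prod).trace ∂(Measure.pi fun _ => haarProbability G) =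
      ((∫ x, oneLinkWeight ρ β x ∂haarProbability G : ℝ) : ℂ) ^ Fintype.card ι *
        ∏ L ∈ S, (((line L).map fun l => oneLinkMatrix ρ β * ρ (a l)).prod).trace := by
  induction S using Finset.induction_on generalizing a with
  | empty =>
    simp only [Finset.sum_empty, pow_zero, one_mul, Finset.prod_empty, mul_one]
    exact integral_prod_oneLinkWeight_eq_pow ρ hρ β a
  | insert L₀ S' hL₀ ih =>
    have hndS' : ∀ L ∈ S', (line L).Nodup := fun L hL => hnd L (Finset.mem_insert_of_mem hL)
    have hdjS' : ∀ L ∈ S', ∀ L' ∈ S', L ≠ L' → (line L).Disjoint (line L') := fun L hL L' hL' h =>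
      hdj L (Finset.mem_insert_of_mem hL) L' (Finset.mem_insert_of_mem hL') h
    have hnd₀ : (line L₀).Nodup := hnd L₀ (Finset.mem_insert_self _ _)
    have hdj₀ : ∀ L ∈ S', (line L₀).Disjoint (line L) := fun L hL =>
      hdj L₀ (Finset.mem_insert_self _ _) L (Finset.mem_insert_of_mem hL) fun h => hL₀ (h ▸ hL)
    -- the block `p` of the links of `line L₀` (kept opaque, so that all instances on `{l // p l}` agree),
    -- enumerated by `eqv`
    obtain ⟨p, hp⟩ : ∃ p : ι → Prop, p = fun l => l ∈ line L₀ := ⟨_, rfl⟩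
    have hpl : ∀ l, p l ↔ l ∈ line L₀ := fun l => by rw [hp]
    haveI hpdec : DecidablePred p := fun l => decidable_of_iff (l ∈ line L₀) (hpl l).symm
    set eqv : Fin (line L₀).length ≃ {l // p l} :=
      (hnd₀.getEquiv (line L₀)).trans (Equiv.subtypeEquivRight fun l => (hpl l).symm) with heqv
    have heqvk : ∀ k : Fin (line L₀).length, ((eqv k : {l // p l}) : ι) = (line L₀)[(k : ℕ)] := fun k => by
      rw [heqv, Equiv.trans_apply, Equiv.subtypeEquivRight_apply_coe, List.Nodup.getEquiv_apply_coe,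
        List.get_eq_getElem]
    have hofFnG : ∀ x : ι → G,
        (List.ofFn fun k : Fin (line L₀).length => x ((eqv k : {l // p l}) : ι)) = (line L₀).map x := fun x => by
      rw [← List.ofFn_getElem_eq_map]
      exact List.ofFn_inj.mpr (funext fun k => by rw [heqvk])
    have hofFnM : ∀ f : ι → Matrix (Fin N) (Fin N) ℂ,
        (List.ofFn fun k : Fin (line L₀).length => f ((eqv k : {l // p l}) : ι)) = (line L₀).map f := fun f => by
      rw [← List.ofFn_getElem_eq_map]
      exact List.ofFn_inj.mpr (funext fun k => by rw [heqvk])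
    -- the two factors of the integrand
    set Ψ : (ι → G) → ℂ := fun x => (∏ l : {l // ¬ p l}, (oneLinkWeight ρ β (a l * (x l)⁻¹) : ℂ)) *
      ∏ L ∈ S', (ρ ((line L).map x).prod).trace with hΨ
    set F : ({l // p l} → G) → ℂ := fun y => (∏ l : {l // p l}, (oneLinkWeight ρ β (a l * (y l)⁻¹) : ℂ)) *
      (ρ (List.ofFn fun k => y (eqv k)).prod).trace with hF
    have hΨi : ∀ x x' : ι → G, (∀ l, ¬ p l → x l = x' l) → Ψ x = Ψ x' := fun x x' hxx' => by
      simp only [hΨ]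
      congr 1
      · exact Finset.prod_congr rfl fun l _ => by rw [hxx' l l.2]
      · refine Finset.prod_congr rfl fun L hL => ?_
        rw [List.map_congr_left fun l hl => hxx' l fun hl₀ => hdj₀ L hL ((hpl l).1 hl₀) hl]
    have hfac : ∀ x : ι → G, (∏ l, (oneLinkWeight ρ β (a l * (x l)⁻¹) : ℂ)) *
        ∏ L ∈ insert L₀ S', (ρ ((line L).map x).prod).trace = F (fun l => x l) * Ψ x := fun x => by
      rw [Finset.prod_insert hL₀, ← Fintype.prod_subtype_mul_prod_subtype p
        (fun l => (oneLinkWeight ρ β (a l * (x l)⁻¹) : ℂ)), hF, hΨ]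
      simp only
      rw [hofFnG x]
      exact mul_mul_mul_comm _ _ _ _
    have hFint : ∫ y, F y ∂(Measure.pi fun _ : {l // p l} => haarProbability G) =
        (((line L₀).map fun l => oneLinkMatrix ρ β * ρ (a l)).prod).trace := by
      simp only [hF]
      rw [integral_block_trace ρ hρ β p eqv a, hofFnM (fun l => oneLinkMatrix ρ β * ρ (a l))]
    -- the induction hypothesis for `a` reset to `1` on the block
    set a' : ι → G := fun l => if p l then 1 else a l with ha'
    have ih' := ih hndS' hdjS' a'
    have hRa' : ∏ L ∈ S', (((line L).map fun l => oneLinkMatrix ρ β * ρ (a' l)).prod).trace =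
        ∏ L ∈ S', (((line L).map fun l => oneLinkMatrix ρ β * ρ (a l)).prod).trace :=
      Finset.prod_congr rfl fun L hL => by
        rw [List.map_congr_left fun l hl => by
          show oneLinkMatrix ρ β * ρ (a' l) = oneLinkMatrix ρ β * ρ (a l)
          rw [ha']
          simp only
          rw [if_neg fun hl₀ => hdj₀ L hL ((hpl l).1 hl₀) hl]]
    set F' : ({l // p l} → G) → ℂ := fun y =>
      ∏ l : {l // p l}, (oneLinkWeight ρ β ((1 : G) * (y l)⁻¹) : ℂ) with hF'
    have h1 : ∀ l : {l // p l}, a' l = 1 := fun l => by simp only [ha', if_pos l.2]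
    have h2 : ∀ l : {l // ¬ p l}, a' l = a l := fun l => by simp only [ha', if_neg l.2]
    have hfac' : ∀ x : ι → G, (∏ l, (oneLinkWeight ρ β (a' l * (x l)⁻¹) : ℂ)) *
        ∏ L ∈ S', (ρ ((line L).map x).prod).trace = F' (fun l => x l) * Ψ x := fun x => by
      rw [← Fintype.prod_subtype_mul_prod_subtype p (fun l => (oneLinkWeight ρ β (a' l * (x l)⁻¹) : ℂ)), hF', hΨ]
      simp only [h1, h2]
      exact mul_assoc _ _ _
    have hF'int : ∫ y, F' y ∂(Measure.pi fun _ : {l // p l} => haarProbability G) =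
        ((∫ x, oneLinkWeight ρ β x ∂haarProbability G : ℝ) : ℂ) ^ (line L₀).length := by
      simp only [hF']
      rw [integral_prod_oneLinkWeight_eq_pow ρ hρ β (fun _ : {l // p l} => (1 : G)), ← Fintype.card_congr eqv,
        Fintype.card_fin]
    simp_rw [hfac'] at ih'
    rw [integral_mul_eq_integral_mul_integral_of_indep p F' Ψ hΨi, hF'int, hRa'] at ih'
    rw [Finset.sum_insert hL₀, Finset.prod_insert hL₀]
    simp_rw [hfac]
    rw [integral_mul_eq_integral_mul_integral_of_indep p F Ψ hΨi, hFint, pow_add]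
    linear_combination (((line L₀).map fun l => oneLinkMatrix ρ β * ρ (a l)).prod).trace * ih'

end Lines

/-! ### The loop integral for Polyakov lines along the three axes; the multi-line witness -/

section MultiWitness

variable {b₁ b₂ b₃ : ℕ} {G : Type*} [Group G] {N : ℕ} (ρ : G →* Matrix (Fin N) (Fin N) ℂ)

/-- A link of the axis-`0` line through `q` has direction `0` and transverse position `q`. [folklore] -/
private theorem mem_line₀ {q : Fin b₂ × Fin b₃} {l : FinSpatialSite b₁ b₂ b₃ × Fin 3}
    (h : l ∈ List.ofFn fun k : Fin b₁ => (((k, q.1, q.2), 0) : FinSpatialSite b₁ b₂ b₃ × Fin 3)) :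
    l.2 = 0 ∧ l.1.2 = q := by
  obtain ⟨k, rfl⟩ := List.mem_ofFn.1 h
  exact ⟨rfl, rfl⟩

/-- A link of the axis-`1` line through `q` has direction `1` and transverse position `q`. [folklore] -/
private theorem mem_line₁ {q : Fin b₁ × Fin b₃} {l : FinSpatialSite b₁ b₂ b₃ × Fin 3}
    (h : l ∈ List.ofFn fun k : Fin b₂ => (((q.1, k, q.2), 1) : FinSpatialSite b₁ b₂ b₃ × Fin 3)) :
    l.2 = 1 ∧ (l.1.1, l.1.2.2) = q := by
  obtain ⟨k, rfl⟩ := List.mem_ofFn.1 h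
  exact ⟨rfl, rfl⟩

/-- A link of the axis-`2` line through `q` has direction `2` and transverse position `q`. [folklore] -/
private theorem mem_line₂ {q : Fin b₁ × Fin b₂} {l : FinSpatialSite b₁ b₂ b₃ × Fin 3}
    (h : l ∈ List.ofFn fun k : Fin b₃ => (((q.1, q.2, k), 2) : FinSpatialSite b₁ b₂ b₃ × Fin 3)) :
    l.2 = 2 ∧ (l.1.1, l.1.2.1) = q := by
  obtain ⟨k, rfl⟩ := List.mem_ofFn.1 h
  exact ⟨rfl, rfl⟩

variable [TopologicalSpace G] [IsTopologicalGroup G] [CompactSpace G] [MeasurableSpace G] [BorelSpace G]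
  [SecondCountableTopology G]

/-- ★ **The loop integral for several Polyakov lines along the three axes.**  For finite sets `S₀, S₁, S₂` of
transverse positions (lines along the axes `0, 1, 2` through them; distinct such lines share no link) and ANY slice `a`:
`H^{|S₀|b₁+|S₁|b₂+|S₂|b₃} · ∫ ∏_l f_β(a_l b_l⁻¹) ∏_{q∈S₀} tr ρ(P⁰_q b) ∏_{q∈S₁} tr ρ(P¹_q b) ∏_{q∈S₂} tr ρ(P²_q b) db
 = H^{#links} · ∏_{q∈S₀} tr(∏_k M(β)ρ(a_{(k,q),0})) · ∏_{q∈S₁} tr(∏_k M(β)ρ(a_{(q₀,k,q₂),1})) · ∏_{q∈S₂} tr(∏_k M(β)ρ(a_{(q₀,q₁,k),2}))`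
(`integral_prod_oneLinkWeight_mul_prod_trace_lines` for the three families of straight lines).
[cite: MontvayMunster1994, §3.2.8 (3.184)–(3.187)] [cite: tHooft1979Flux, §4 (4.6)–(4.10)] -/
theorem integral_prod_oneLinkWeight_mul_prod_trace_polyakov (hρ : Continuous ρ) (β : ℝ)
    (S₀ : Finset (Fin b₂ × Fin b₃)) (S₁ : Finset (Fin b₁ × Fin b₃)) (S₂ : Finset (Fin b₁ × Fin b₂))
    (a : FinSpatialSite b₁ b₂ b₃ × Fin 3 → G) :
    ((∫ x, oneLinkWeight ρ β x ∂haarProbability G : ℝ) : ℂ) ^ (S₀.card * b₁ + S₁.card * b₂ + S₂.card * b₃) *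
        ∫ b, (∏ l, (oneLinkWeight ρ β (a l * (b l)⁻¹) : ℂ)) *
          ((∏ q ∈ S₀, (ρ (finSlicePolyakovHolonomy b q)).trace) *
            ((∏ q ∈ S₁, (ρ (finSlicePolyakovHolonomy₁ b q)).trace) *
              ∏ q ∈ S₂, (ρ (finSlicePolyakovHolonomy₂ b q)).trace))
          ∂(Measure.pi fun _ : FinSpatialSite b₁ b₂ b₃ × Fin 3 => haarProbability G) =
      ((∫ x, oneLinkWeight ρ β x ∂haarProbability G : ℝ) : ℂ) ^ Fintype.card (FinSpatialSite b₁ b₂ b₃ × Fin 3) *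
        ((∏ q ∈ S₀, ((List.ofFn fun k : Fin b₁ => oneLinkMatrix ρ β * ρ (a ((k, q.1, q.2), 0))).prod).trace) *
          ((∏ q ∈ S₁, ((List.ofFn fun k : Fin b₂ => oneLinkMatrix ρ β * ρ (a ((q.1, k, q.2), 1))).prod).trace) *
            ∏ q ∈ S₂, ((List.ofFn fun k : Fin b₃ => oneLinkMatrix ρ β * ρ (a ((q.1, q.2, k), 2))).prod).trace)) := by
  classical
  -- the three families of lines as lists of links, indexed by a sum type
  let line : (Fin b₂ × Fin b₃) ⊕ ((Fin b₁ × Fin b₃) ⊕ (Fin b₁ × Fin b₂)) →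
      List (FinSpatialSite b₁ b₂ b₃ × Fin 3) :=
    Sum.elim (fun q => List.ofFn fun k : Fin b₁ => (((k, q.1, q.2), 0) : FinSpatialSite b₁ b₂ b₃ × Fin 3))
      (Sum.elim (fun q => List.ofFn fun k : Fin b₂ => (((q.1, k, q.2), 1) : FinSpatialSite b₁ b₂ b₃ × Fin 3))
        (fun q => List.ofFn fun k : Fin b₃ => (((q.1, q.2, k), 2) : FinSpatialSite b₁ b₂ b₃ × Fin 3)))
  have hnd : ∀ L ∈ S₀.disjSum (S₁.disjSum S₂), (line L).Nodup := by
    rintro (q | q | q) -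
    · exact List.nodup_ofFn.mpr fun k k' h => by
        simpa using congrArg (fun l : FinSpatialSite b₁ b₂ b₃ × Fin 3 => l.1.1) h
    · exact List.nodup_ofFn.mpr fun k k' h => by
        simpa using congrArg (fun l : FinSpatialSite b₁ b₂ b₃ × Fin 3 => l.1.2.1) h
    · exact List.nodup_ofFn.mpr fun k k' h => by
        simpa using congrArg (fun l : FinSpatialSite b₁ b₂ b₃ × Fin 3 => l.1.2.2) h
  have hdj : ∀ L ∈ S₀.disjSum (S₁.disjSum S₂), ∀ L' ∈ S₀.disjSum (S₁.disjSum S₂), L ≠ L' →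
      (line L).Disjoint (line L') := by
    rintro (q | q | q) - (q' | q' | q') - hne l hl hl'
    · exact hne (by rw [← (mem_line₀ hl).2, ← (mem_line₀ hl').2])
    · exact absurd ((mem_line₀ hl).1.symm.trans (mem_line₁ hl').1) (by decide)
    · exact absurd ((mem_line₀ hl).1.symm.trans (mem_line₂ hl').1) (by decide)
    · exact absurd ((mem_line₁ hl).1.symm.trans (mem_line₀ hl').1) (by decide)
    · exact hne (by rw [← (mem_line₁ hl).2, ← (mem_line₁ hl').2])
    · exact absurd ((mem_line₁ hl).1.symm.trans (mem_line₂ hl').1) (by decide)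
    · exact absurd ((mem_line₂ hl).1.symm.trans (mem_line₀ hl').1) (by decide)
    · exact absurd ((mem_line₂ hl).1.symm.trans (mem_line₁ hl').1) (by decide)
    · exact hne (by rw [← (mem_line₂ hl).2, ← (mem_line₂ hl').2])
  have h := integral_prod_oneLinkWeight_mul_prod_trace_lines ρ hρ β line (S₀.disjSum (S₁.disjSum S₂)) hnd hdj a
  simp only [Finset.sum_disjSum, Finset.prod_disjSum, line, Sum.elim_inl, Sum.elim_inr, List.length_ofFn,
    Finset.sum_const, smul_eq_mul, List.map_ofFn, Function.comp_def] at h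
  simp only [finSlicePolyakovHolonomy, finSlicePolyakovHolonomy₁, finSlicePolyakovHolonomy₂]
  rw [add_assoc]
  exact h

omit [SecondCountableTopology G] in
/-- The ordered product `M ρ(g) · M ⋯ M` of a line carrying `g` on its first link has trace `tr(M^{m+1} ρ(g))`
(cyclicity of the trace; plumbing). [cite: MontvayMunster1994, §3.2.8 (3.187)] -/
private theorem trace_prod_ofFn_oneLinkMatrix_mul_head (β : ℝ) {m : ℕ} (g : G) :
    ((List.ofFn fun k : Fin (m + 1) => oneLinkMatrix ρ β * ρ (if (k : ℕ) = 0 then g else 1)).prod).trace =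
      ((oneLinkMatrix ρ β) ^ (m + 1) * ρ g).trace := by
  have hprod : (List.ofFn fun k : Fin (m + 1) => oneLinkMatrix ρ β * ρ (if (k : ℕ) = 0 then g else 1)).prod =
      oneLinkMatrix ρ β * ρ g * (oneLinkMatrix ρ β) ^ m := by
    rw [List.ofFn_succ, List.prod_cons]
    simp [Fin.val_succ, List.ofFn_const, List.prod_replicate]
  rw [hprod, Matrix.trace_mul_cycle, pow_succ]

omit [CompactSpace G] [MeasurableSpace G] [BorelSpace G] [SecondCountableTopology G] in
/-- The multi-line witness `u_S(b) = e^{β S_sp(b)/2} ∏_{q∈S₀} tr ρ(P⁰_q b) ∏_{q∈S₁} tr ρ(P¹_q b) ∏_{q∈S₂} tr ρ(P²_q b)` is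
continuous (plumbing). [folklore] -/
private theorem continuous_multiWitness (hρ : Continuous ρ) (β : ℝ) (S₀ : Finset (Fin b₂ × Fin b₃))
    (S₁ : Finset (Fin b₁ × Fin b₃)) (S₂ : Finset (Fin b₁ × Fin b₂)) :
    Continuous fun b : FinSpatialSite b₁ b₂ b₃ × Fin 3 → G =>
      (Real.exp (β * finTorusSpatialAction ρ b / 2) : ℂ) *
        ((∏ q ∈ S₀, (ρ (finSlicePolyakovHolonomy b q)).trace) *
          ((∏ q ∈ S₁, (ρ (finSlicePolyakovHolonomy₁ b q)).trace) *
            ∏ q ∈ S₂, (ρ (finSlicePolyakovHolonomy₂ b q)).trace)) :=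
  (Complex.continuous_ofReal.comp (Real.continuous_exp.comp ((continuous_const.mul
    (continuous_finTorusSpatialAction ρ hρ)).div_const 2))).mul
    ((continuous_finsetProd _ fun q _ => (hρ.comp (continuous_finSlicePolyakovHolonomy q)).matrix_trace).mul
      ((continuous_finsetProd _ fun q _ => (hρ.comp (continuous_finSlicePolyakovHolonomy₁ q)).matrix_trace).mul
        (continuous_finsetProd _ fun q _ => (hρ.comp (continuous_finSlicePolyakovHolonomy₂ q)).matrix_trace)))

omit [TopologicalSpace G] [IsTopologicalGroup G] [CompactSpace G] [MeasurableSpace G] [BorelSpace G]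
  [SecondCountableTopology G] in
/-- The product of traced Polyakov loops is gauge invariant (plumbing). [cite: BorgsSeiler1983, §II.3 Lemma II.4 (p. 336)] -/
private theorem multiWitness_finSliceGaugeTransform [NeZero b₁] [NeZero b₂] [NeZero b₃]
    (S₀ : Finset (Fin b₂ × Fin b₃)) (S₁ : Finset (Fin b₁ × Fin b₃)) (S₂ : Finset (Fin b₁ × Fin b₂))
    (c : FinSpatialSite b₁ b₂ b₃ → G) (x : FinSpatialSite b₁ b₂ b₃ × Fin 3 → G) :
    (∏ q ∈ S₀, (ρ (finSlicePolyakovHolonomy (finSliceGaugeTransform c x) q)).trace) *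
        ((∏ q ∈ S₁, (ρ (finSlicePolyakovHolonomy₁ (finSliceGaugeTransform c x) q)).trace) *
          ∏ q ∈ S₂, (ρ (finSlicePolyakovHolonomy₂ (finSliceGaugeTransform c x) q)).trace) =
      (∏ q ∈ S₀, (ρ (finSlicePolyakovHolonomy x q)).trace) *
        ((∏ q ∈ S₁, (ρ (finSlicePolyakovHolonomy₁ x q)).trace) * ∏ q ∈ S₂, (ρ (finSlicePolyakovHolonomy₂ x q)).trace) := by
  simp only [trace_rep_finSlicePolyakovHolonomy_finSliceGaugeTransform,
    trace_rep_finSlicePolyakovHolonomy₁_finSliceGaugeTransform, trace_rep_finSlicePolyakovHolonomy₂_finSliceGaugeTransform]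

/-- **One transfer step applied to `e^{β S_sp/2} · W` for a continuous gauge-invariant slice function `W`**:
`∫ K_β(a, b) e^{β S_sp(b)/2} W(b) db = e^{−β S_sp(a)/2} · ∫ ∏_l f_β(a_l b_l⁻¹) W(b) db` — the half spatial weights at `b`
cancel, the Gauss-law average drops out (`integral_integral_exp_neg_finTorusTemporalAction_mul`) and the temporal weight
factorises over links (`exp_neg_finTorusTemporalAction_one_eq_prod`); `integral_finTorusSliceKernel_mul_polyakovWitness`
is the case `W = tr ρ(P_q)`. [cite: MontvayMunster1994, §3.2.6 (3.144) and §3.2.8 (3.184)] [cite: tHooft1979Flux, §4 (4.6)–(4.8)] -/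
theorem integral_finTorusSliceKernel_mul_exp_mul (hρ : Continuous ρ) (β : ℝ)
    {W : (FinSpatialSite b₁ b₂ b₃ × Fin 3 → G) → ℂ} (hWc : Continuous W)
    (hWg : ∀ (c : FinSpatialSite b₁ b₂ b₃ → G) (x : FinSpatialSite b₁ b₂ b₃ × Fin 3 → G),
      W (finSliceGaugeTransform c x) = W x)
    (a : FinSpatialSite b₁ b₂ b₃ × Fin 3 → G) :
    ∫ b, (finTorusSliceKernel ρ β a b : ℂ) * ((Real.exp (β * finTorusSpatialAction ρ b / 2) : ℂ) * W b)
        ∂(Measure.pi fun _ : FinSpatialSite b₁ b₂ b₃ × Fin 3 => haarProbability G) =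
      (Real.exp (-(β * finTorusSpatialAction ρ a / 2)) : ℂ) *
        ∫ b, (∏ l, (oneLinkWeight ρ β (a l * (b l)⁻¹) : ℂ)) * W b
          ∂(Measure.pi fun _ : FinSpatialSite b₁ b₂ b₃ × Fin 3 => haarProbability G) := by
  have h1 : ∀ b : FinSpatialSite b₁ b₂ b₃ × Fin 3 → G, (finTorusSliceKernel ρ β a b : ℂ) *
      ((Real.exp (β * finTorusSpatialAction ρ b / 2) : ℂ) * W b) =
      (Real.exp (-(β * finTorusSpatialAction ρ a / 2)) : ℂ) *
        (((∫ g, Real.exp (-(β * finTorusTemporalAction ρ a g b))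
            ∂(Measure.pi fun _ : FinSpatialSite b₁ b₂ b₃ => haarProbability G) : ℝ) : ℂ) * W b) := fun b => by
    have hcancel : (Real.exp (-(β * finTorusSpatialAction ρ b / 2)) : ℂ) *
        (Real.exp (β * finTorusSpatialAction ρ b / 2) : ℂ) = 1 := by
      rw [← Complex.ofReal_mul, ← Real.exp_add, neg_add_cancel, Real.exp_zero, Complex.ofReal_one]
    unfold finTorusSliceKernel
    rw [Complex.ofReal_mul, Complex.ofReal_mul]
    calc (Real.exp (-(β * finTorusSpatialAction ρ a / 2)) : ℂ) *
          ((∫ g, Real.exp (-(β * finTorusTemporalAction ρ a g b))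
            ∂(Measure.pi fun _ : FinSpatialSite b₁ b₂ b₃ => haarProbability G) : ℝ) : ℂ) *
          (Real.exp (-(β * finTorusSpatialAction ρ b / 2)) : ℂ) *
          ((Real.exp (β * finTorusSpatialAction ρ b / 2) : ℂ) * W b)
        = (Real.exp (-(β * finTorusSpatialAction ρ a / 2)) : ℂ) *
          ((∫ g, Real.exp (-(β * finTorusTemporalAction ρ a g b))
            ∂(Measure.pi fun _ : FinSpatialSite b₁ b₂ b₃ => haarProbability G) : ℝ) : ℂ) *
          ((Real.exp (-(β * finTorusSpatialAction ρ b / 2)) : ℂ) * (Real.exp (β * finTorusSpatialAction ρ b / 2) : ℂ)) *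
          W b := by ring
      _ = _ := by rw [hcancel]; ring
  simp_rw [h1]
  rw [integral_const_mul, integral_integral_exp_neg_finTorusTemporalAction_mul ρ hρ β hWc hWg a]
  congr 1
  refine integral_congr_ae (Eventually.of_forall fun b => ?_)
  dsimp only
  rw [exp_neg_finTorusTemporalAction_one_eq_prod, Complex.ofReal_prod]

/-- ★ **The multi-line witness survives one transfer step**: for `β > 0`, `N ≥ 1` and all sides `≥ 1`, the function
`a ↦ ∫ K_β(a, b) u_S(b) db` (`u_S` = half spatial weight × the traced Polyakov loops through `S₀, S₁, S₂`) is continuous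
and non-zero at the slice carrying a suitable `g_i ∈ G` on every link of direction `i` leaving the sheet `{p_i = 0}`
(`integral_prod_oneLinkWeight_mul_prod_trace_polyakov`, `exists_trace_oneLinkMatrix_pow_mul_rep_ne_zero`), hence NOT
a.e. zero. [cite: tHooft1979Flux, §4 (4.6)–(4.10)] [cite: MontvayMunster1994, §3.2.8 (3.184)–(3.187)] -/
theorem not_ae_eq_zero_integral_finTorusSliceKernel_mul_multiWitness (hρ : Continuous ρ)
    (hρu : ∀ g, ρ g ∈ Matrix.unitaryGroup (Fin N) ℂ) [NeZero N] [NeZero b₁] [NeZero b₂] [NeZero b₃] {β : ℝ}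
    (hβ : 0 < β) (S₀ : Finset (Fin b₂ × Fin b₃)) (S₁ : Finset (Fin b₁ × Fin b₃)) (S₂ : Finset (Fin b₁ × Fin b₂)) :
    ¬ ((fun a : FinSpatialSite b₁ b₂ b₃ × Fin 3 → G => ∫ b, (finTorusSliceKernel ρ β a b : ℂ) *
        ((Real.exp (β * finTorusSpatialAction ρ b / 2) : ℂ) *
          ((∏ q ∈ S₀, (ρ (finSlicePolyakovHolonomy b q)).trace) *
            ((∏ q ∈ S₁, (ρ (finSlicePolyakovHolonomy₁ b q)).trace) *
              ∏ q ∈ S₂, (ρ (finSlicePolyakovHolonomy₂ b q)).trace)))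
        ∂(Measure.pi fun _ : FinSpatialSite b₁ b₂ b₃ × Fin 3 => haarProbability G))
        =ᵐ[Measure.pi fun _ : FinSpatialSite b₁ b₂ b₃ × Fin 3 => haarProbability G] 0) := by
  set μS : Measure (FinSpatialSite b₁ b₂ b₃ × Fin 3 → G) := Measure.pi fun _ => haarProbability G with hμS
  -- the gauge-invariant part of the witness
  set W : (FinSpatialSite b₁ b₂ b₃ × Fin 3 → G) → ℂ := fun b =>
    (∏ q ∈ S₀, (ρ (finSlicePolyakovHolonomy b q)).trace) *
      ((∏ q ∈ S₁, (ρ (finSlicePolyakovHolonomy₁ b q)).trace) * ∏ q ∈ S₂, (ρ (finSlicePolyakovHolonomy₂ b q)).trace)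
    with hW
  have hWc : Continuous W :=
    (continuous_finsetProd _ fun q _ => (hρ.comp (continuous_finSlicePolyakovHolonomy q)).matrix_trace).mul
      ((continuous_finsetProd _ fun q _ => (hρ.comp (continuous_finSlicePolyakovHolonomy₁ q)).matrix_trace).mul
        (continuous_finsetProd _ fun q _ => (hρ.comp (continuous_finSlicePolyakovHolonomy₂ q)).matrix_trace))
  have hWg : ∀ (c : FinSpatialSite b₁ b₂ b₃ → G) (x : FinSpatialSite b₁ b₂ b₃ × Fin 3 → G),
      W (finSliceGaugeTransform c x) = W x := fun c x => multiWitness_finSliceGaugeTransform ρ S₀ S₁ S₂ c x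
  -- the special slice: `g i` on every link of direction `i` leaving the sheet `{p_i = 0}`
  obtain ⟨m₁, hm₁⟩ := Nat.exists_eq_succ_of_ne_zero (NeZero.ne b₁)
  obtain ⟨m₂, hm₂⟩ := Nat.exists_eq_succ_of_ne_zero (NeZero.ne b₂)
  obtain ⟨m₃, hm₃⟩ := Nat.exists_eq_succ_of_ne_zero (NeZero.ne b₃)
  obtain ⟨g₀, hg₀⟩ := exists_trace_oneLinkMatrix_pow_mul_rep_ne_zero ρ hρ hρu hβ b₁
  obtain ⟨g₁, hg₁⟩ := exists_trace_oneLinkMatrix_pow_mul_rep_ne_zero ρ hρ hρu hβ b₂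
  obtain ⟨g₂, hg₂⟩ := exists_trace_oneLinkMatrix_pow_mul_rep_ne_zero ρ hρ hρu hβ b₃
  set a₀ : FinSpatialSite b₁ b₂ b₃ × Fin 3 → G := fun l =>
    if finSpatialCoord l.1 l.2 = 0 then (![g₀, g₁, g₂] : Fin 3 → G) l.2 else 1 with ha₀
  have ha₀0 : ∀ (q : Fin b₂ × Fin b₃) (k : Fin b₁), a₀ ((k, q.1, q.2), 0) = if (k : ℕ) = 0 then g₀ else 1 :=
    fun q k => rfl
  have ha₀1 : ∀ (q : Fin b₁ × Fin b₃) (k : Fin b₂), a₀ ((q.1, k, q.2), 1) = if (k : ℕ) = 0 then g₁ else 1 :=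
    fun q k => rfl
  have ha₀2 : ∀ (q : Fin b₁ × Fin b₂) (k : Fin b₃), a₀ ((q.1, q.2, k), 2) = if (k : ℕ) = 0 then g₂ else 1 :=
    fun q k => rfl
  -- the loop integral at `a₀` does not vanish
  have hH : ((∫ x, oneLinkWeight ρ β x ∂haarProbability G : ℝ) : ℂ) ≠ 0 :=
    Complex.ofReal_ne_zero.2 (integral_oneLinkWeight_pos ρ hρ β).ne'
  have hloop : (∫ b, (∏ l, (oneLinkWeight ρ β (a₀ l * (b l)⁻¹) : ℂ)) * W b ∂μS) ≠ 0 := by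
    have h := integral_prod_oneLinkWeight_mul_prod_trace_polyakov ρ hρ β S₀ S₁ S₂ a₀
    simp only [ha₀0, ha₀1, ha₀2] at h
    intro h0
    rw [hW] at h0
    rw [h0, mul_zero] at h
    refine (mul_ne_zero (pow_ne_zero _ hH) (mul_ne_zero (Finset.prod_ne_zero_iff.2 fun q _ => ?_)
      (mul_ne_zero (Finset.prod_ne_zero_iff.2 fun q _ => ?_) (Finset.prod_ne_zero_iff.2 fun q _ => ?_)))) h.symm
    · subst hm₁
      rw [trace_prod_ofFn_oneLinkMatrix_mul_head]
      exact hg₀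
    · subst hm₂
      rw [trace_prod_ofFn_oneLinkMatrix_mul_head]
      exact hg₁
    · subst hm₃
      rw [trace_prod_ofFn_oneLinkMatrix_mul_head]
      exact hg₂
  have hne : (∫ b, (finTorusSliceKernel ρ β a₀ b : ℂ) *
      ((Real.exp (β * finTorusSpatialAction ρ b / 2) : ℂ) * W b) ∂μS) ≠ 0 := by
    rw [integral_finTorusSliceKernel_mul_exp_mul ρ hρ β hWc hWg a₀]
    exact mul_ne_zero (Complex.ofReal_ne_zero.2 (Real.exp_pos _).ne') hloop
  -- continuity of `κ u_S`
  have huc : Continuous fun b : FinSpatialSite b₁ b₂ b₃ × Fin 3 → G =>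
      (Real.exp (β * finTorusSpatialAction ρ b / 2) : ℂ) * W b :=
    (Complex.continuous_ofReal.comp (Real.continuous_exp.comp ((continuous_const.mul
      (continuous_finTorusSpatialAction ρ hρ)).div_const 2))).mul hWc
  obtain ⟨B, hB⟩ := isCompact_univ.exists_bound_of_continuousOn huc.continuousOn
  obtain ⟨C, hC⟩ := exists_norm_finTorusSliceKernel_le (b₁ := b₁) (b₂ := b₂) (b₃ := b₃) ρ hρ β
  have hKc := continuous_uncurry_finTorusSliceKernel (b₁ := b₁) (b₂ := b₂) (b₃ := b₃) ρ hρ β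
  have hC0 : 0 ≤ C := (norm_nonneg _).trans (hC 1 1)
  have hcont : Continuous fun a : FinSpatialSite b₁ b₂ b₃ × Fin 3 → G => ∫ b, (finTorusSliceKernel ρ β a b : ℂ) *
      ((Real.exp (β * finTorusSpatialAction ρ b / 2) : ℂ) * W b) ∂μS := by
    refine continuous_of_dominated (bound := fun _ => C * B) (fun a => ?_) (fun a => Eventually.of_forall fun b => ?_)
      (integrable_const _) (Eventually.of_forall fun b => ?_)
    · exact ((Complex.continuous_ofReal.comp (hKc.comp (continuous_const.prodMk continuous_id))).mul
        huc).aestronglyMeasurable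
    · rw [norm_mul, Complex.norm_real]
      exact mul_le_mul (hC a b) (hB b (Set.mem_univ b)) (norm_nonneg _) hC0
    · exact (Complex.continuous_ofReal.comp (hKc.comp (continuous_id.prodMk continuous_const))).mul continuous_const
  intro hae
  have heq := (Continuous.ae_eq_iff_eq μS hcont continuous_const).1 hae
  exact hne (congrFun heq a₀)

end MultiWitness

/-! ### Populated sectors from a covariant witness; every electric flux of a finite box is populated -/

section AllFluxes

variable {G : Type*} [Group G] [TopologicalSpace G] [IsTopologicalGroup G] [CompactSpace G]
  [MeasurableSpace G] [BorelSpace G] [SecondCountableTopology G] {N : ℕ} (ρ : G →* Matrix (Fin N) (Fin N) ℂ)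
  {Γ : Type*} [AddCommGroup Γ] [Fintype Γ]

/-- **A flux sector that carries a covariant witness surviving one transfer step is populated**: for a continuous
slice function `u` of flux `ψ` (`u ∘ T_{φ k} = ψ(k) · u`, 't Hooft (4.8)–(4.9)) with `∫ K_β(·, b) u(b) db` NOT a.e. zero,
`0 < Re Z_ψ(M+2)` for every `M` (the kernel-level criterion `re_fluxSector_pos_of_covariant` fed with the spectral data
of the Wilson slice kernel).  Every compact metrisable `G`, continuous unitary `ρ`, `β ≥ 0`, central temporal twists.
[cite: tHooft1979Flux, §4 (4.6)–(4.10) and §5 (5.1)–(5.4)] [cite: ReedSimonIV1978, §XIII.12 Thm XIII.43] -/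
theorem wilsonFinTorusFluxPartition_re_pos_of_witness (hρ : Continuous ρ)
    (hρu : ∀ g, ρ g ∈ Matrix.unitaryGroup (Fin N) ℂ) {β : ℝ} (hβ : 0 ≤ β) {φ : Γ → Fin 4 → G}
    (hφ0 : φ 0 = 1) (hφadd : ∀ k k', φ (k + k') = φ k * φ k')
    (hφc : ∀ k (i : Fin 3), φ k i.castSucc ∈ Subgroup.center G) {ψ : AddChar Γ ℂ} {b₁ b₂ b₃ : ℕ}
    {u : (FinSpatialSite b₁ b₂ b₃ × Fin 3 → G) → ℂ} (huc : Continuous u)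
    (hcov : ∀ (k : Γ) (x : FinSpatialSite b₁ b₂ b₃ × Fin 3 → G), u (finSliceTwist (φ k) x) = ψ k * u x)
    (hκu : ¬ ((fun a : FinSpatialSite b₁ b₂ b₃ × Fin 3 → G => ∫ y, (finTorusSliceKernel ρ β a y : ℂ) * u y
        ∂(Measure.pi fun _ : FinSpatialSite b₁ b₂ b₃ × Fin 3 => haarProbability G))
        =ᵐ[Measure.pi fun _ : FinSpatialSite b₁ b₂ b₃ × Fin 3 => haarProbability G] 0)) (M : ℕ) :
    0 < (wilsonFinTorusFluxPartition ρ β φ ψ b₁ b₂ b₃ (M + 2)).re := by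
  obtain ⟨C, A, s, hcnt, b, lam, i₀, hC, hA, hb, hlam, -, -⟩ :=
    exists_eigenbasis_finTorusSliceKernel hρ hρu hβ b₁ b₂ b₃
  haveI : Countable s := hcnt
  have hK := stronglyMeasurable_uncurry_finTorusSliceKernel (b₁ := b₁) (b₂ := b₂) (b₃ := b₃) ρ hρ β
  have hsymm : ∀ x y : FinSpatialSite b₁ b₂ b₃ × Fin 3 → G,
      finTorusSliceKernel ρ β x y = finTorusSliceKernel ρ β y x := finTorusSliceKernel_symm ρ hρu β
  have hT0 : (finSliceTwist (φ 0) : (FinSpatialSite b₁ b₂ b₃ × Fin 3 → G) → _) = id := by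
    rw [hφ0]; exact finSliceTwist_one
  have hTadd : ∀ (k k' : Γ) (x : FinSpatialSite b₁ b₂ b₃ × Fin 3 → G),
      finSliceTwist (φ (k + k')) x = finSliceTwist (φ k) (finSliceTwist (φ k') x) := fun k k' x => by
    rw [finSliceTwist_finSliceTwist, hφadd]
  have hT : ∀ k : Γ, MeasurePreserving (finSliceTwist (φ k) : (FinSpatialSite b₁ b₂ b₃ × Fin 3 → G) → _)
      (Measure.pi fun _ => haarProbability G) (Measure.pi fun _ => haarProbability G) :=
    fun k => measurePreserving_finSliceTwist (φ k)
  obtain ⟨B, hB⟩ := isCompact_univ.exists_bound_of_continuousOn huc.continuousOn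
  exact re_fluxSector_pos_of_covariant (T := fun k => finSliceTwist (φ k)) hK hC hsymm hA hb (fun i => (hlam i).1)
    hT hT0 hTadd (z := fun k n => wilsonFinTorusTwistedPartition ρ β (φ k) b₁ b₂ b₃ n)
    (fun k M => wilsonFinTorusTwistedPartition_eq_integral_iterate ρ hρ β (hφc k) b₁ b₂ b₃ M) ψ huc.measurable
    (fun x => hB x (Set.mem_univ x)) hcov hκu M

/-- **The conjugate witness populates the opposite flux**: under the hypotheses of
`wilsonFinTorusFluxPartition_re_pos_of_witness` also `0 < Re Z_{−ψ}(M+2)` (`conj ∘ u` has flux `−ψ`,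
`(−ψ)(k) = ψ(−k) = conj ψ(k)`, and `∫ K conj u = conj ∫ K u` since the kernel is real).
[cite: tHooft1979Flux, §4 (4.6)–(4.10) and §5 (5.1)–(5.4)] -/
theorem wilsonFinTorusFluxPartition_re_pos_of_witness_neg (hρ : Continuous ρ)
    (hρu : ∀ g, ρ g ∈ Matrix.unitaryGroup (Fin N) ℂ) {β : ℝ} (hβ : 0 ≤ β) {φ : Γ → Fin 4 → G}
    (hφ0 : φ 0 = 1) (hφadd : ∀ k k', φ (k + k') = φ k * φ k')
    (hφc : ∀ k (i : Fin 3), φ k i.castSucc ∈ Subgroup.center G) {ψ : AddChar Γ ℂ} {b₁ b₂ b₃ : ℕ}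
    {u : (FinSpatialSite b₁ b₂ b₃ × Fin 3 → G) → ℂ} (huc : Continuous u)
    (hcov : ∀ (k : Γ) (x : FinSpatialSite b₁ b₂ b₃ × Fin 3 → G), u (finSliceTwist (φ k) x) = ψ k * u x)
    (hκu : ¬ ((fun a : FinSpatialSite b₁ b₂ b₃ × Fin 3 → G => ∫ y, (finTorusSliceKernel ρ β a y : ℂ) * u y
        ∂(Measure.pi fun _ : FinSpatialSite b₁ b₂ b₃ × Fin 3 => haarProbability G))
        =ᵐ[Measure.pi fun _ : FinSpatialSite b₁ b₂ b₃ × Fin 3 => haarProbability G] 0)) (M : ℕ) :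
    0 < (wilsonFinTorusFluxPartition ρ β φ (-ψ) b₁ b₂ b₃ (M + 2)).re := by
  refine wilsonFinTorusFluxPartition_re_pos_of_witness ρ hρ hρu hβ hφ0 hφadd hφc (u := fun x => conj (u x))
    (Complex.continuous_conj.comp huc) (fun k x => ?_) (fun h => hκu ?_) M
  · show conj (u (finSliceTwist (φ k) x)) = (-ψ) k * conj (u x)
    rw [hcov, map_mul, AddChar.neg_apply, AddChar.map_neg_eq_conj]
  · filter_upwards [h] with a ha
    have h1 : ∫ y, (finTorusSliceKernel ρ β a y : ℂ) * conj (u y)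
        ∂(Measure.pi fun _ : FinSpatialSite b₁ b₂ b₃ × Fin 3 => haarProbability G) =
        conj (∫ y, (finTorusSliceKernel ρ β a y : ℂ) * u y
          ∂(Measure.pi fun _ : FinSpatialSite b₁ b₂ b₃ × Fin 3 => haarProbability G)) := by
      rw [← integral_conj]
      refine integral_congr_ae (Eventually.of_forall fun y => ?_)
      simp only [map_mul, Complex.conj_ofReal]
    have ha' : conj (∫ y, (finTorusSliceKernel ρ β a y : ℂ) * u y
        ∂(Measure.pi fun _ : FinSpatialSite b₁ b₂ b₃ × Fin 3 => haarProbability G)) = 0 := by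
      rw [← h1]; exact ha
    rw [Pi.zero_apply]
    simpa using ha'

omit [TopologicalSpace G] [IsTopologicalGroup G] [CompactSpace G] [MeasurableSpace G] [BorelSpace G]
  [SecondCountableTopology G] in
/-- **Centre charge of the multi-line witness**: under the slice twist by `z` (central in the spatial directions,
seen by `ρ` through the scalars `ω i`), `u_S(T_z x) = ω₀^{|S₀|} ω₁^{|S₁|} ω₂^{|S₂|} · u_S(x)` — each traced loop along
axis `i` acquires `ω i` ('t Hooft (4.8)–(4.9)), the spatial weight is invariant.
[cite: tHooft1979Flux, §4 (4.8)–(4.10)] -/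
theorem multiWitness_finSliceTwist {b₁ b₂ b₃ : ℕ} [NeZero b₁] [NeZero b₂] [NeZero b₃]
    {z : Fin 4 → G} (hz : ∀ i : Fin 3, z i.castSucc ∈ Subgroup.center G) {ω : Fin 3 → ℂ}
    (hω : ∀ i : Fin 3, ρ (z i.castSucc) = (ω i) • (1 : Matrix (Fin N) (Fin N) ℂ)) (β : ℝ)
    (S₀ : Finset (Fin b₂ × Fin b₃)) (S₁ : Finset (Fin b₁ × Fin b₃)) (S₂ : Finset (Fin b₁ × Fin b₂))
    (x : FinSpatialSite b₁ b₂ b₃ × Fin 3 → G) :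
    (Real.exp (β * finTorusSpatialAction ρ (finSliceTwist z x) / 2) : ℂ) *
        ((∏ q ∈ S₀, (ρ (finSlicePolyakovHolonomy (finSliceTwist z x) q)).trace) *
          ((∏ q ∈ S₁, (ρ (finSlicePolyakovHolonomy₁ (finSliceTwist z x) q)).trace) *
            ∏ q ∈ S₂, (ρ (finSlicePolyakovHolonomy₂ (finSliceTwist z x) q)).trace)) =
      (ω 0 ^ S₀.card * ω 1 ^ S₁.card * ω 2 ^ S₂.card) *
        ((Real.exp (β * finTorusSpatialAction ρ x / 2) : ℂ) *
          ((∏ q ∈ S₀, (ρ (finSlicePolyakovHolonomy x q)).trace) *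
            ((∏ q ∈ S₁, (ρ (finSlicePolyakovHolonomy₁ x q)).trace) *
              ∏ q ∈ S₂, (ρ (finSlicePolyakovHolonomy₂ x q)).trace))) := by
  have hω0 : ρ (z 0) = (ω 0) • (1 : Matrix (Fin N) (Fin N) ℂ) := hω 0
  have hω1 : ρ (z 1) = (ω 1) • (1 : Matrix (Fin N) (Fin N) ℂ) := hω 1
  have hω2 : ρ (z 2) = (ω 2) • (1 : Matrix (Fin N) (Fin N) ℂ) := hω 2
  rw [finTorusSpatialAction_finSliceTwist ρ hz]
  simp only [trace_rep_finSlicePolyakovHolonomy_finSliceTwist ρ hω0, trace_rep_finSlicePolyakovHolonomy₁_finSliceTwist ρ hω1,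
    trace_rep_finSlicePolyakovHolonomy₂_finSliceTwist ρ hω2, Finset.prod_mul_distrib, Finset.prod_const]
  ring

/-- ★ **Several Polyakov lines populate the sum of their fluxes.**  For `β > 0`, a continuous unitary `ρ` (`N ≥ 1`) of a
compact metrisable group, a box with all sides `≥ 1`, central temporal twists `φ : Γ → (Fin 4 → G)` seen by `ρ` through
the characters `ψ i` in the three spatial directions (`ρ(φ k i) = ψ_i(k)·1`), and finite sets `S₀, S₁, S₂` of transverse
positions: the sector of flux `|S₀|·ψ₀ + |S₁|·ψ₁ + |S₂|·ψ₂` is populated, **`0 < Re Z_{|S₀|ψ₀+|S₁|ψ₁+|S₂|ψ₂}(M+2)`** for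
every `M` ('t Hooft (4.10): the integers `e_i` count how many times a loop creation operator acted in direction `i`).
[cite: tHooft1979Flux, §4 (4.6)–(4.10) and §5 (5.1)–(5.4)] [cite: MontvayMunster1994, §3.2.8 (3.184)–(3.187)] -/
theorem wilsonFinTorusFluxPartition_re_pos_of_lines (hρ : Continuous ρ)
    (hρu : ∀ g, ρ g ∈ Matrix.unitaryGroup (Fin N) ℂ) [NeZero N] {β : ℝ} (hβ : 0 < β) {φ : Γ → Fin 4 → G}
    (hφ0 : φ 0 = 1) (hφadd : ∀ k k', φ (k + k') = φ k * φ k')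
    (hφc : ∀ k (i : Fin 3), φ k i.castSucc ∈ Subgroup.center G) {ψ : Fin 3 → AddChar Γ ℂ}
    (hψ : ∀ (k : Γ) (i : Fin 3), ρ (φ k i.castSucc) = (ψ i k) • (1 : Matrix (Fin N) (Fin N) ℂ))
    {b₁ b₂ b₃ : ℕ} [NeZero b₁] [NeZero b₂] [NeZero b₃]
    (S₀ : Finset (Fin b₂ × Fin b₃)) (S₁ : Finset (Fin b₁ × Fin b₃)) (S₂ : Finset (Fin b₁ × Fin b₂)) (M : ℕ) :
    0 < (wilsonFinTorusFluxPartition ρ β φ (S₀.card • ψ 0 + S₁.card • ψ 1 + S₂.card • ψ 2) b₁ b₂ b₃ (M + 2)).re :=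
  wilsonFinTorusFluxPartition_re_pos_of_witness ρ hρ hρu hβ.le hφ0 hφadd hφc
    (continuous_multiWitness ρ hρ β S₀ S₁ S₂)
    (fun k x => by
      rw [multiWitness_finSliceTwist ρ (hφc k) (fun i => hψ k i) β S₀ S₁ S₂ x]
      simp only [AddChar.add_apply, AddChar.nsmul_apply])
    (not_ae_eq_zero_integral_finTorusSliceKernel_mul_multiWitness ρ hρ hρu hβ S₀ S₁ S₂) M

/-- **… and the reversed lines populate the opposite flux**: `0 < Re Z_{−(|S₀|ψ₀+|S₁|ψ₁+|S₂|ψ₂)}(M+2)`.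
[cite: tHooft1979Flux, §4 (4.6)–(4.10) and §5 (5.1)–(5.4)] -/
theorem wilsonFinTorusFluxPartition_re_pos_of_lines_neg (hρ : Continuous ρ)
    (hρu : ∀ g, ρ g ∈ Matrix.unitaryGroup (Fin N) ℂ) [NeZero N] {β : ℝ} (hβ : 0 < β) {φ : Γ → Fin 4 → G}
    (hφ0 : φ 0 = 1) (hφadd : ∀ k k', φ (k + k') = φ k * φ k')
    (hφc : ∀ k (i : Fin 3), φ k i.castSucc ∈ Subgroup.center G) {ψ : Fin 3 → AddChar Γ ℂ}
    (hψ : ∀ (k : Γ) (i : Fin 3), ρ (φ k i.castSucc) = (ψ i k) • (1 : Matrix (Fin N) (Fin N) ℂ))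
    {b₁ b₂ b₃ : ℕ} [NeZero b₁] [NeZero b₂] [NeZero b₃]
    (S₀ : Finset (Fin b₂ × Fin b₃)) (S₁ : Finset (Fin b₁ × Fin b₃)) (S₂ : Finset (Fin b₁ × Fin b₂)) (M : ℕ) :
    0 < (wilsonFinTorusFluxPartition ρ β φ (-(S₀.card • ψ 0 + S₁.card • ψ 1 + S₂.card • ψ 2)) b₁ b₂ b₃ (M + 2)).re :=
  wilsonFinTorusFluxPartition_re_pos_of_witness_neg ρ hρ hρu hβ.le hφ0 hφadd hφc
    (continuous_multiWitness ρ hρ β S₀ S₁ S₂)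
    (fun k x => by
      rw [multiWitness_finSliceTwist ρ (hφc k) (fun i => hψ k i) β S₀ S₁ S₂ x]
      simp only [AddChar.add_apply, AddChar.nsmul_apply])
    (not_ae_eq_zero_integral_finTorusSliceKernel_mul_multiWitness ρ hρ hρu hβ S₀ S₁ S₂) M

/-- ★ **Every electric flux with enough transverse room is populated**: with `ψ i` the character by which `ρ` sees the
temporal twist of direction `i`, for all `n₀ ≤ b₂b₃`, `n₁ ≤ b₁b₃`, `n₂ ≤ b₁b₂` (the number of distinct straight lines
available in each direction): **`0 < Re Z_{n₀ψ₀+n₁ψ₁+n₂ψ₂}(M+2)`** for every `M`; `β > 0`, `N ≥ 1`, all sides `≥ 1`.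
[cite: tHooft1979Flux, §4 (4.6)–(4.10) and §5 (5.1)–(5.4)] [cite: MontvayMunster1994, §3.2.8 (3.184)–(3.187)] -/
theorem wilsonFinTorusFluxPartition_re_pos_of_flux (hρ : Continuous ρ)
    (hρu : ∀ g, ρ g ∈ Matrix.unitaryGroup (Fin N) ℂ) [NeZero N] {β : ℝ} (hβ : 0 < β) {φ : Γ → Fin 4 → G}
    (hφ0 : φ 0 = 1) (hφadd : ∀ k k', φ (k + k') = φ k * φ k')
    (hφc : ∀ k (i : Fin 3), φ k i.castSucc ∈ Subgroup.center G) {ψ : Fin 3 → AddChar Γ ℂ}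
    (hψ : ∀ (k : Γ) (i : Fin 3), ρ (φ k i.castSucc) = (ψ i k) • (1 : Matrix (Fin N) (Fin N) ℂ))
    {b₁ b₂ b₃ : ℕ} [NeZero b₁] [NeZero b₂] [NeZero b₃] {n₀ n₁ n₂ : ℕ}
    (hn₀ : n₀ ≤ b₂ * b₃) (hn₁ : n₁ ≤ b₁ * b₃) (hn₂ : n₂ ≤ b₁ * b₂) (M : ℕ) :
    0 < (wilsonFinTorusFluxPartition ρ β φ (n₀ • ψ 0 + n₁ • ψ 1 + n₂ • ψ 2) b₁ b₂ b₃ (M + 2)).re := by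
  obtain ⟨S₀, -, hS₀⟩ := Finset.exists_subset_card_eq (s := (Finset.univ : Finset (Fin b₂ × Fin b₃)))
    (n := n₀) (by simpa [Finset.card_univ] using hn₀)
  obtain ⟨S₁, -, hS₁⟩ := Finset.exists_subset_card_eq (s := (Finset.univ : Finset (Fin b₁ × Fin b₃)))
    (n := n₁) (by simpa [Finset.card_univ] using hn₁)
  obtain ⟨S₂, -, hS₂⟩ := Finset.exists_subset_card_eq (s := (Finset.univ : Finset (Fin b₁ × Fin b₂)))
    (n := n₂) (by simpa [Finset.card_univ] using hn₂)
  rw [← hS₀, ← hS₁, ← hS₂]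
  exact wilsonFinTorusFluxPartition_re_pos_of_lines ρ hρ hρu hβ hφ0 hφadd hφc hψ S₀ S₁ S₂ M

/-- **… and its negative**: `0 < Re Z_{−(n₀ψ₀+n₁ψ₁+n₂ψ₂)}(M+2)` under the same hypotheses.
[cite: tHooft1979Flux, §4 (4.6)–(4.10) and §5 (5.1)–(5.4)] -/
theorem wilsonFinTorusFluxPartition_re_pos_of_flux_neg (hρ : Continuous ρ)
    (hρu : ∀ g, ρ g ∈ Matrix.unitaryGroup (Fin N) ℂ) [NeZero N] {β : ℝ} (hβ : 0 < β) {φ : Γ → Fin 4 → G}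
    (hφ0 : φ 0 = 1) (hφadd : ∀ k k', φ (k + k') = φ k * φ k')
    (hφc : ∀ k (i : Fin 3), φ k i.castSucc ∈ Subgroup.center G) {ψ : Fin 3 → AddChar Γ ℂ}
    (hψ : ∀ (k : Γ) (i : Fin 3), ρ (φ k i.castSucc) = (ψ i k) • (1 : Matrix (Fin N) (Fin N) ℂ))
    {b₁ b₂ b₃ : ℕ} [NeZero b₁] [NeZero b₂] [NeZero b₃] {n₀ n₁ n₂ : ℕ}
    (hn₀ : n₀ ≤ b₂ * b₃) (hn₁ : n₁ ≤ b₁ * b₃) (hn₂ : n₂ ≤ b₁ * b₂) (M : ℕ) :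
    0 < (wilsonFinTorusFluxPartition ρ β φ (-(n₀ • ψ 0 + n₁ • ψ 1 + n₂ • ψ 2)) b₁ b₂ b₃ (M + 2)).re := by
  obtain ⟨S₀, -, hS₀⟩ := Finset.exists_subset_card_eq (s := (Finset.univ : Finset (Fin b₂ × Fin b₃)))
    (n := n₀) (by simpa [Finset.card_univ] using hn₀)
  obtain ⟨S₁, -, hS₁⟩ := Finset.exists_subset_card_eq (s := (Finset.univ : Finset (Fin b₁ × Fin b₃)))
    (n := n₁) (by simpa [Finset.card_univ] using hn₁)
  obtain ⟨S₂, -, hS₂⟩ := Finset.exists_subset_card_eq (s := (Finset.univ : Finset (Fin b₁ × Fin b₂)))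
    (n := n₂) (by simpa [Finset.card_univ] using hn₂)
  rw [← hS₀, ← hS₁, ← hS₂]
  exact wilsonFinTorusFluxPartition_re_pos_of_lines_neg ρ hρ hρu hβ hφ0 hφadd hφc hψ S₀ S₁ S₂ M

omit [TopologicalSpace G] [IsTopologicalGroup G] [CompactSpace G] [MeasurableSpace G] [BorelSpace G]
  [SecondCountableTopology G] in
/-- Every character of the finite group `Γ` has finite (positive) additive order: `|Γ| • ψ = 0`. [folklore] -/
private theorem addOrderOf_addChar_pos (ψ : AddChar Γ ℂ) : 0 < addOrderOf ψ := by
  refine (isOfFinAddOrder_iff_nsmul_eq_zero.2 ⟨Fintype.card Γ, Fintype.card_pos, ?_⟩).addOrderOf_pos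
  ext k
  rw [AddChar.nsmul_apply, ← AddChar.map_nsmul_eq_pow, card_nsmul_eq_zero, AddChar.map_zero_eq_one, AddChar.zero_apply]

/-- ★ **Every electric flux in the lattice generated by the seen characters is populated, given room**: if the box has
at least `ord(ψ_i) − 1` straight lines in each direction `i` (`ord(ψ₀) ≤ b₂b₃ + 1` etc.; e.g. every side `≥ N − 1`
suffices for twists of order `N`), then **every** `χ` in the subgroup of `Γ̂` generated by `ψ₀, ψ₁, ψ₂` is populated:
`0 < Re Z_χ(M+2)` for all `M` — for `G = SU(N)`, the fundamental `ρ` and 't Hooft's centre twists (`Γ = (ℤ/N)³`,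
`ψ_i` the coordinate characters) this is EVERY electric flux `e ∈ (ℤ/N)³` of the box.
[cite: tHooft1979Flux, §4 (4.5)–(4.10) and §5 (5.1)–(5.4)] -/
theorem wilsonFinTorusFluxPartition_re_pos_of_mem_closure (hρ : Continuous ρ)
    (hρu : ∀ g, ρ g ∈ Matrix.unitaryGroup (Fin N) ℂ) [NeZero N] {β : ℝ} (hβ : 0 < β) {φ : Γ → Fin 4 → G}
    (hφ0 : φ 0 = 1) (hφadd : ∀ k k', φ (k + k') = φ k * φ k')
    (hφc : ∀ k (i : Fin 3), φ k i.castSucc ∈ Subgroup.center G) {ψ : Fin 3 → AddChar Γ ℂ}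
    (hψ : ∀ (k : Γ) (i : Fin 3), ρ (φ k i.castSucc) = (ψ i k) • (1 : Matrix (Fin N) (Fin N) ℂ))
    {b₁ b₂ b₃ : ℕ} [NeZero b₁] [NeZero b₂] [NeZero b₃] (h₀ : addOrderOf (ψ 0) ≤ b₂ * b₃ + 1)
    (h₁ : addOrderOf (ψ 1) ≤ b₁ * b₃ + 1) (h₂ : addOrderOf (ψ 2) ≤ b₁ * b₂ + 1) {χ : AddChar Γ ℂ}
    (hχ : χ ∈ AddSubgroup.closure (Set.range ψ)) (M : ℕ) :
    0 < (wilsonFinTorusFluxPartition ρ β φ χ b₁ b₂ b₃ (M + 2)).re := by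
  obtain ⟨z, rfl⟩ := AddSubgroup.mem_closure_range_iff_of_fintype.1 hχ
  -- reduce each integer coefficient modulo the (positive) order of `ψ i`
  have hord : ∀ i, (0 : ℤ) < (addOrderOf (ψ i) : ℤ) := fun i => Int.natCast_pos.2 (addOrderOf_addChar_pos (ψ i))
  set n : Fin 3 → ℕ := fun i => (z i % (addOrderOf (ψ i) : ℤ)).toNat with hn
  have hnz : ∀ i, (n i : ℤ) = z i % (addOrderOf (ψ i) : ℤ) := fun i =>
    Int.toNat_of_nonneg (Int.emod_nonneg _ (hord i).ne')
  have hnlt : ∀ i, n i < addOrderOf (ψ i) := fun i => by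
    have h := Int.emod_lt_of_pos (z i) (hord i)
    rw [← hnz i] at h
    exact_mod_cast h
  have hzn : ∀ i, z i • ψ i = n i • ψ i := fun i => by
    rw [← natCast_zsmul, hnz i, mod_addOrderOf_zsmul]
  have hsum : ∑ i, z i • ψ i = n 0 • ψ 0 + n 1 • ψ 1 + n 2 • ψ 2 := by
    simp only [hzn, Fin.sum_univ_three]
  rw [hsum]
  exact wilsonFinTorusFluxPartition_re_pos_of_flux ρ hρ hρu hβ hφ0 hφadd hφc hψ
    (by have := hnlt 0; omega) (by have := hnlt 1; omega) (by have := hnlt 2; omega) M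

/-! ### Consequences for 't Hooft's flux energies -/

/-- ★ **The flux energy of every electric flux with room exists unconditionally**:
`(1/M) log(Re Z_0(M+2) / Re Z_χ(M+2)) → E_χ` for `χ = n₀ψ₀ + n₁ψ₁ + n₂ψ₂`, `n₀ ≤ b₂b₃`, `n₁ ≤ b₁b₃`, `n₂ ≤ b₁b₂`
(`tendsto_wilsonFinTorusFluxEnergy` with its population hypothesis discharged by `…_re_pos_of_flux`).
[cite: tHooft1979Flux, §4 (4.10) and §5 after (5.4)] [cite: Greensite2011, §4.4 (4.41)–(4.44)] -/
theorem tendsto_wilsonFinTorusFluxEnergy_of_flux (hρ : Continuous ρ)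
    (hρu : ∀ g, ρ g ∈ Matrix.unitaryGroup (Fin N) ℂ) [NeZero N] {β : ℝ} (hβ : 0 < β) {φ : Γ → Fin 4 → G}
    (hφ0 : φ 0 = 1) (hφadd : ∀ k k', φ (k + k') = φ k * φ k')
    (hφc : ∀ k (i : Fin 3), φ k i.castSucc ∈ Subgroup.center G) {ψ : Fin 3 → AddChar Γ ℂ}
    (hψ : ∀ (k : Γ) (i : Fin 3), ρ (φ k i.castSucc) = (ψ i k) • (1 : Matrix (Fin N) (Fin N) ℂ))
    {b₁ b₂ b₃ : ℕ} [NeZero b₁] [NeZero b₂] [NeZero b₃] {n₀ n₁ n₂ : ℕ}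
    (hn₀ : n₀ ≤ b₂ * b₃) (hn₁ : n₁ ≤ b₁ * b₃) (hn₂ : n₂ ≤ b₁ * b₂) :
    Tendsto (fun M : ℕ => Real.log ((wilsonFinTorusFluxPartition ρ β φ 0 b₁ b₂ b₃ (M + 2)).re /
        (wilsonFinTorusFluxPartition ρ β φ (n₀ • ψ 0 + n₁ • ψ 1 + n₂ • ψ 2) b₁ b₂ b₃ (M + 2)).re) / M) atTop
      (𝓝 (wilsonFinTorusFluxEnergy ρ β φ (n₀ • ψ 0 + n₁ • ψ 1 + n₂ • ψ 2) b₁ b₂ b₃)) :=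
  tendsto_wilsonFinTorusFluxEnergy ρ hρ hρu hβ.le hφ0 hφadd hφc b₁ b₂ b₃
    (wilsonFinTorusFluxPartition_re_pos_of_flux ρ hρ hρu hβ hφ0 hφadd hφc hψ hn₀ hn₁ hn₂ 1)

/-- ★ **Every non-zero electric flux with room costs at least the finite-volume gap, unconditionally**:
`−log tanh(3Nβ·b₁b₂b₃) ≤ E_χ` for `χ = n₀ψ₀ + n₁ψ₁ + n₂ψ₂ ≠ 0` with room. [cite: tHooft1979Flux, §4 (4.10) and §5 after (5.4)]
[cite: Hopf1963, Thm 4] -/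
theorem neg_log_tanh_le_wilsonFinTorusFluxEnergy_of_flux (hρ : Continuous ρ)
    (hρu : ∀ g, ρ g ∈ Matrix.unitaryGroup (Fin N) ℂ) [NeZero N] {β : ℝ} (hβ : 0 < β) {φ : Γ → Fin 4 → G}
    (hφ0 : φ 0 = 1) (hφadd : ∀ k k', φ (k + k') = φ k * φ k')
    (hφc : ∀ k (i : Fin 3), φ k i.castSucc ∈ Subgroup.center G) {ψ : Fin 3 → AddChar Γ ℂ}
    (hψ : ∀ (k : Γ) (i : Fin 3), ρ (φ k i.castSucc) = (ψ i k) • (1 : Matrix (Fin N) (Fin N) ℂ))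
    {b₁ b₂ b₃ : ℕ} [NeZero b₁] [NeZero b₂] [NeZero b₃] {n₀ n₁ n₂ : ℕ}
    (hn₀ : n₀ ≤ b₂ * b₃) (hn₁ : n₁ ≤ b₁ * b₃) (hn₂ : n₂ ≤ b₁ * b₂) (hχ0 : n₀ • ψ 0 + n₁ • ψ 1 + n₂ • ψ 2 ≠ 0) :
    -Real.log (Real.tanh (3 * N * β * ((b₁ : ℝ) * b₂ * b₃))) ≤
      wilsonFinTorusFluxEnergy ρ β φ (n₀ • ψ 0 + n₁ • ψ 1 + n₂ • ψ 2) b₁ b₂ b₃ :=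
  neg_log_tanh_le_wilsonFinTorusFluxEnergy ρ hρ hρu hβ.le hφ0 hφadd hφc b₁ b₂ b₃ hχ0
    (wilsonFinTorusFluxPartition_re_pos_of_flux ρ hρ hρu hβ hφ0 hφadd hφc hψ hn₀ hn₁ hn₂ 1)

/-- ★ **Every non-zero electric flux with room has strictly positive energy, unconditionally**: `0 < E_χ` for
`χ = n₀ψ₀ + n₁ψ₁ + n₂ψ₂ ≠ 0` with room — a ONE-BOX statement (the lower bound degenerates exponentially in the spatial
volume; nothing about the behaviour as the box grows, 't Hooft §7). [cite: tHooft1979Flux, §4 (4.10) and §5 after (5.4)]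
[cite: Hopf1963, Thm 4] -/
theorem wilsonFinTorusFluxEnergy_pos_of_flux (hρ : Continuous ρ)
    (hρu : ∀ g, ρ g ∈ Matrix.unitaryGroup (Fin N) ℂ) [NeZero N] {β : ℝ} (hβ : 0 < β) {φ : Γ → Fin 4 → G}
    (hφ0 : φ 0 = 1) (hφadd : ∀ k k', φ (k + k') = φ k * φ k')
    (hφc : ∀ k (i : Fin 3), φ k i.castSucc ∈ Subgroup.center G) {ψ : Fin 3 → AddChar Γ ℂ}
    (hψ : ∀ (k : Γ) (i : Fin 3), ρ (φ k i.castSucc) = (ψ i k) • (1 : Matrix (Fin N) (Fin N) ℂ))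
    {b₁ b₂ b₃ : ℕ} [NeZero b₁] [NeZero b₂] [NeZero b₃] {n₀ n₁ n₂ : ℕ}
    (hn₀ : n₀ ≤ b₂ * b₃) (hn₁ : n₁ ≤ b₁ * b₃) (hn₂ : n₂ ≤ b₁ * b₂) (hχ0 : n₀ • ψ 0 + n₁ • ψ 1 + n₂ • ψ 2 ≠ 0) :
    0 < wilsonFinTorusFluxEnergy ρ β φ (n₀ • ψ 0 + n₁ • ψ 1 + n₂ • ψ 2) b₁ b₂ b₃ :=
  wilsonFinTorusFluxEnergy_pos ρ hρ hρu hβ.le hφ0 hφadd hφc b₁ b₂ b₃ hχ0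
    (wilsonFinTorusFluxPartition_re_pos_of_flux ρ hρ hρu hβ hφ0 hφadd hφc hψ hn₀ hn₁ hn₂ 1)

/-- ★ **Every non-zero flux in the subgroup generated by the seen characters has strictly positive energy**, given
room `ord(ψ₀) ≤ b₂b₃+1`, `ord(ψ₁) ≤ b₁b₃+1`, `ord(ψ₂) ≤ b₁b₂+1` — for `SU(N)`, the fundamental `ρ` and 't Hooft's centre
twists: `E(e) > 0` for EVERY electric flux `e ≠ 0` of a box with enough transverse room, unconditionally (one box,
fixed `β`). [cite: tHooft1979Flux, §4 (4.5)–(4.10) and §5 after (5.4)] [cite: Hopf1963, Thm 4] -/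
theorem wilsonFinTorusFluxEnergy_pos_of_mem_closure (hρ : Continuous ρ)
    (hρu : ∀ g, ρ g ∈ Matrix.unitaryGroup (Fin N) ℂ) [NeZero N] {β : ℝ} (hβ : 0 < β) {φ : Γ → Fin 4 → G}
    (hφ0 : φ 0 = 1) (hφadd : ∀ k k', φ (k + k') = φ k * φ k')
    (hφc : ∀ k (i : Fin 3), φ k i.castSucc ∈ Subgroup.center G) {ψ : Fin 3 → AddChar Γ ℂ}
    (hψ : ∀ (k : Γ) (i : Fin 3), ρ (φ k i.castSucc) = (ψ i k) • (1 : Matrix (Fin N) (Fin N) ℂ))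
    {b₁ b₂ b₃ : ℕ} [NeZero b₁] [NeZero b₂] [NeZero b₃] (h₀ : addOrderOf (ψ 0) ≤ b₂ * b₃ + 1)
    (h₁ : addOrderOf (ψ 1) ≤ b₁ * b₃ + 1) (h₂ : addOrderOf (ψ 2) ≤ b₁ * b₂ + 1) {χ : AddChar Γ ℂ}
    (hχ : χ ∈ AddSubgroup.closure (Set.range ψ)) (hχ0 : χ ≠ 0) :
    0 < wilsonFinTorusFluxEnergy ρ β φ χ b₁ b₂ b₃ :=
  wilsonFinTorusFluxEnergy_pos ρ hρ hρu hβ.le hφ0 hφadd hφc b₁ b₂ b₃ hχ0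
    (wilsonFinTorusFluxPartition_re_pos_of_mem_closure ρ hρ hρu hβ hφ0 hφadd hφc hψ h₀ h₁ h₂ hχ 1)

end AllFluxes

/-! ### The flux sectors under the exchange of two spatial axes; unit fluxes along the axes `1` and `2` -/

section AxisExchange

variable {G : Type*} [Group G] [TopologicalSpace G] [IsTopologicalGroup G] [CompactSpace G]
  [MeasurableSpace G] [BorelSpace G] [SecondCountableTopology G] {N : ℕ} (ρ : G →* Matrix (Fin N) (Fin N) ℂ)
  {Γ : Type*} [AddCommGroup Γ] [Fintype Γ]

omit [SecondCountableTopology G] in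
/-- **The flux sectors under the exchange of the spatial axes `0 ↔ 1`**: `Z_ψ^{φ}(b₁,b₂,b₃; n) = Z_ψ^{φ ∘ (0 1)}(b₂,b₁,b₃; n)`
(the twist family is relabelled, `wilsonFinTorusTwistedPartition_swap01`; every `ψ`, real `β`).
[cite: tHooft1979Flux, §2 after (2.6) and §5 (5.4)] -/
theorem wilsonFinTorusFluxPartition_swap01 (hρ : Continuous ρ) (β : ℝ) (φ : Γ → Fin 4 → G) (ψ : AddChar Γ ℂ)
    (b₁ b₂ b₃ n : ℕ) :
    wilsonFinTorusFluxPartition ρ β φ ψ b₁ b₂ b₃ n =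
      wilsonFinTorusFluxPartition ρ β (fun k i => φ k (Equiv.swap (0 : Fin 4) 1 i)) ψ b₂ b₁ b₃ n := by
  rw [wilsonFinTorusFluxPartition_def, wilsonFinTorusFluxPartition_def]
  refine congrArg _ (Finset.sum_congr rfl fun k _ => ?_)
  rw [wilsonFinTorusTwistedPartition_swap01 ρ hρ β (φ k)]

omit [SecondCountableTopology G] in
/-- **The flux sectors under the exchange of the spatial axes `0 ↔ 2`**: `Z_ψ^{φ}(b₁,b₂,b₃; n) = Z_ψ^{φ ∘ (0 2)}(b₃,b₂,b₁; n)`.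
[cite: tHooft1979Flux, §2 after (2.6) and §5 (5.4)] -/
theorem wilsonFinTorusFluxPartition_swap02 (hρ : Continuous ρ) (β : ℝ) (φ : Γ → Fin 4 → G) (ψ : AddChar Γ ℂ)
    (b₁ b₂ b₃ n : ℕ) :
    wilsonFinTorusFluxPartition ρ β φ ψ b₁ b₂ b₃ n =
      wilsonFinTorusFluxPartition ρ β (fun k i => φ k (Equiv.swap (0 : Fin 4) 2 i)) ψ b₃ b₂ b₁ n := by
  rw [wilsonFinTorusFluxPartition_def, wilsonFinTorusFluxPartition_def]
  refine congrArg _ (Finset.sum_congr rfl fun k _ => ?_)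
  rw [wilsonFinTorusTwistedPartition_swap02 ρ hρ β (φ k)]

/-- ★ **The unit electric flux along axis `1` is populated**: if `ρ` sees the twist of direction `1` through `ψ`
(`ρ(φ k 1) = ψ(k)·1`; nothing is assumed about the other directions), then `0 < Re Z_ψ(M+2)` — the axis-`0` theorem
`wilsonFinTorusFluxPartition_re_pos_of_unitFlux` on the box with the axes `0, 1` exchanged.
[cite: tHooft1979Flux, §4 (4.6)–(4.10) and §5 (5.1)–(5.4)] -/
theorem wilsonFinTorusFluxPartition_re_pos_of_unitFlux₁ (hρ : Continuous ρ)
    (hρu : ∀ g, ρ g ∈ Matrix.unitaryGroup (Fin N) ℂ) [NeZero N] {β : ℝ} (hβ : 0 < β) {φ : Γ → Fin 4 → G}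
    (hφ0 : φ 0 = 1) (hφadd : ∀ k k', φ (k + k') = φ k * φ k')
    (hφc : ∀ k (i : Fin 3), φ k i.castSucc ∈ Subgroup.center G) {ψ : AddChar Γ ℂ}
    (hψ : ∀ k, ρ (φ k 1) = (ψ k) • (1 : Matrix (Fin N) (Fin N) ℂ)) (b₁ b₂ b₃ : ℕ) [NeZero b₁] [NeZero b₂]
    [NeZero b₃] (M : ℕ) :
    0 < (wilsonFinTorusFluxPartition ρ β φ ψ b₁ b₂ b₃ (M + 2)).re := by
  have hsw : ∀ i : Fin 3, ∃ j : Fin 3, Equiv.swap (0 : Fin 4) 1 i.castSucc = j.castSucc := by decide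
  rw [wilsonFinTorusFluxPartition_swap01 ρ hρ]
  refine wilsonFinTorusFluxPartition_re_pos_of_unitFlux ρ hρ hρu hβ
    (φ := fun k i => φ k (Equiv.swap (0 : Fin 4) 1 i)) ?_ (fun k k' => ?_) (fun k i => ?_) (fun k => ?_) b₂ b₁ b₃ M
  · funext i
    rw [hφ0]
    rfl
  · funext i
    rw [hφadd]
    rfl
  · obtain ⟨j, hj⟩ := hsw i
    show φ k (Equiv.swap (0 : Fin 4) 1 i.castSucc) ∈ Subgroup.center G
    rw [hj]
    exact hφc k j
  · show ρ (φ k (Equiv.swap (0 : Fin 4) 1 0)) = (ψ k) • (1 : Matrix (Fin N) (Fin N) ℂ)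
    rw [Equiv.swap_apply_left]
    exact hψ k

/-- ★ **The unit electric flux along axis `2` is populated**: if `ρ(φ k 2) = ψ(k)·1` for all `k`, then
`0 < Re Z_ψ(M+2)` (axes `0, 2` exchanged). [cite: tHooft1979Flux, §4 (4.6)–(4.10) and §5 (5.1)–(5.4)] -/
theorem wilsonFinTorusFluxPartition_re_pos_of_unitFlux₂ (hρ : Continuous ρ)
    (hρu : ∀ g, ρ g ∈ Matrix.unitaryGroup (Fin N) ℂ) [NeZero N] {β : ℝ} (hβ : 0 < β) {φ : Γ → Fin 4 → G}
    (hφ0 : φ 0 = 1) (hφadd : ∀ k k', φ (k + k') = φ k * φ k')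
    (hφc : ∀ k (i : Fin 3), φ k i.castSucc ∈ Subgroup.center G) {ψ : AddChar Γ ℂ}
    (hψ : ∀ k, ρ (φ k 2) = (ψ k) • (1 : Matrix (Fin N) (Fin N) ℂ)) (b₁ b₂ b₃ : ℕ) [NeZero b₁] [NeZero b₂]
    [NeZero b₃] (M : ℕ) :
    0 < (wilsonFinTorusFluxPartition ρ β φ ψ b₁ b₂ b₃ (M + 2)).re := by
  have hsw : ∀ i : Fin 3, ∃ j : Fin 3, Equiv.swap (0 : Fin 4) 2 i.castSucc = j.castSucc := by decide
  rw [wilsonFinTorusFluxPartition_swap02 ρ hρ]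
  refine wilsonFinTorusFluxPartition_re_pos_of_unitFlux ρ hρ hρu hβ
    (φ := fun k i => φ k (Equiv.swap (0 : Fin 4) 2 i)) ?_ (fun k k' => ?_) (fun k i => ?_) (fun k => ?_) b₃ b₂ b₁ M
  · funext i
    rw [hφ0]
    rfl
  · funext i
    rw [hφadd]
    rfl
  · obtain ⟨j, hj⟩ := hsw i
    show φ k (Equiv.swap (0 : Fin 4) 2 i.castSucc) ∈ Subgroup.center G
    rw [hj]
    exact hφc k j
  · show ρ (φ k (Equiv.swap (0 : Fin 4) 2 0)) = (ψ k) • (1 : Matrix (Fin N) (Fin N) ℂ)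
    rw [Equiv.swap_apply_left]
    exact hψ k

end AxisExchange

end Literature.MathematicalPhysics.QuantumFieldTheory

end
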